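import Literature.Probability.Percolation.FivePointHolomorphyFaces
import HarnessLib

/-!
# Boundary values of the five-point observables: the six-point transport at a boundary edge, the boundary normalisation and the
boundary support law, for every five-marked discrete domain

Topic `Literature/Probability/Percolation`; lane pcv-sawmu (CriticalPhenomena), door (v-d) «what the five-disorder observables
compute». Setting: the interface layer of `FiveMarkedLoops.lean` (D1-v2: `Joined`, `midEdgeProb`, `patternProb`, `sparseObs`) on a
five-marked discrete domain `D : TriMarkedDomain 5` (Bollobás–Riordan 2006, Ch. 7 §7.2.2). The tree's five-point normalisation
(`FivePointNormalisation.lean`) and its six-point transport are stated for INNER edges of `H_G` (`x` an interior face, both bond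
endpoints in `G`). This file carries them to EVERY edge of `H_G` whose bond has an endpoint in `G` — in particular to the BOUNDARY
edges (bond = a boundary dart `(g, o)` of some stretch, `g ∈ G`, `o ∉ G`), including the ten edges at the corner faces `y_i` — and
proves the two boundary laws of the lane's door (v-d):

* **(N∂) boundary normalisation** `boundaryNormalisation_holds`: `Σ_{r : Fin 5} midEdgeProb D r c x x' = 1` at every boundary edge
  of every arc (in fact `sum_midEdgeProb_eq_one`: at every edge of `H_G`);
* **(B∂) boundary support** `boundarySupport_holds`: at a boundary edge of the arc `A_i` the pattern probability `H_{r,M}` vanishes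
  unless `(r, M) ∈ {(i,A), (i,B), (i+1,A), (i+1,B), (i+3,A)}` — the five non-crossing perfect matchings of the six boundary points
  `(z, y_{i+1}, y_{i+2}, y_{i+3}, y_{i+4}, y_i)`; hence (`sparseObs_arc_*`) on `A_i` the sparse observables `F_{i+2}, F_{i+3}, F_{i+4}`
  are one-class rays (`−τ·H_{i+1,B}`, `H_{i+3,A}`, `−τ²·H_{i,B}`) and `F_i, F_{i+1}` are two-class.

Proof (pcv-sawmu b-engine-2 g7 on b-step0 g10's typed targets). (1) The BOUNDARY SIX-POINT SPACE `loopSpace6b D g o s` with XOR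
parity «odd faces = corners XOR {s}» (the tree's `N5.loopSpace6` asks «corners OR {s}», which is empty when `s` is a corner face)
and its classes `InClassb`; off the corner faces it is the tree's space (`loopSpace6b_eq_of_not_corner`), at a corner endpoint `y_k`
it is `{ξ ∈ loopSpace D k : b₀ ∉ ξ}` with `y_k` isolated (`cornerEnd_isolated`). (2) N1∂ `sixCount_b`: `#T6∂(x) + #T6∂(x') = 2 ^ #G`
uniformly (split `{ξ ⊆ hBonds : odd = corners Δ {x}}` by `b₀ ∈ ξ`). (3) N2∂ `sixStructure_gen` and N3∂ `sixTransport_b`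
(`#W∂_{r,M}(x) + #W∂_{r,M}(x') = #{T ⊆ G : Match_M(r) ∧ (x or x' joined to y_r)}`): off the corners the tree's N2/N3 chain re-run —
its proofs use the inner-edge hypothesis `v ∈ G` only through «`x`, `x'` are not corner faces» (`sixStructure_b`, `transportErase_b`,
`transportCore_b`, `transportSplit_b`, texts = the tree proofs with `inner_facts ↦ bdry_facts`); at a corner endpoint `y_k` and class
index `k` a direct bijection `B ↦ B ∖ {b₀}` (`transport_corner_self`), for a class index `j ≠ k` the one-sided involution
`A ↦ A ∆ γ(IP_j(A))` (`transport_corner_other`). (4) (N∂) by the N4 assembly verbatim. (5) F2∂ `classSupport_b`: delete the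
`s`-component, realise the rest by a colouring (`loopSurj_holds`); the WHITE PATH (`white_of_reach`: every `G`-vertex of every face of
the component is closed — the marked site `v_r` sees the two super-arcs, colours propagate across non-bicoloured bonds) gives
`g ∉ σ`, and `b₀` not bicoloured gives `arcColour r false i = false`, i.e. `r ∈ {i, i+1, i+3}`; for `(i+3, B)` pattern `B` is an open
crossing `A_{r+1} ↔ A_{r+3}` (`fiveMarkedLoopLemma_holds`) while the closed chain along the component (`closed_chain_to_markSite`)
is a closed crossing `A_{r+2} → v_r ∈ A_r`, contradicting `five_markedDomain_duality`. (6) (B∂) = N3∂ + F2∂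
(`patternProb_eq_zero_of_not_allowed`).

Provenance: the support rule and the boundary normalisation were found on the exact tables of the lane's pre-registered
boundary-value cell (MINING-PREREG Am. AI «P-BV5» / AI-b P1, four five-marked domains, two enumeration codes; then Am. AK on two fresh
shapes with a third checker: support 68/68 + 76/76, (N∂) 68/68 + 76/76, zero exceptions), typed as targets by b-step0 g10 (c215adec),
proved here for every domain.

Status in print. (N∂): not located; nearest Khristoforov–Smirnov 2021, Definition 3 (p. 4; four disorders, where Σ_j H_j = 1 is
definitional) and eq. (4) (p. 5; boundary values on ∂_jΩ) [cite: KhristoforovSmirnov2021, §2 Definition 3 (p. 4), eq. (4) (p. 5)];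
six-disorder case announced as in preparation in [cite: KhristoforovSkopenkovSmirnov2025, §1]. With five marks the identity is NOT
definitional (five reference-corner probabilities, each under its own boundary condition, proved equal-summing via the boundary
six-point transport). (B∂): not located; nearest Khristoforov–Smirnov 2021, eq. (4) and Remark 6 (p. 5; three disorders: on ∂_jΩ the
class [z → u_j] is absent, = Smirnov's boundary condition for H_j) [cite: KhristoforovSmirnov2021, §2 eq. (4) and Remark 6 (p. 5)]
[cite: Smirnov2001, §2] and Khristoforov–Skopenkov–Smirnov, Lemma 3.6 «Boundary values» (four boundary disorders a, b, u, v: F(u,v)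
lies on the segment spanned by the two surviving weights, by cyclic order) [cite: KhristoforovSkopenkovSmirnov2025, §3 Lemma 3.6]; the
number of surviving classes, five = C₃, is the dimension of the continuum six-point solution space [cite: FloresKleban2015NullState1,
Abstract and §1]; six-disorder lattice case announced as in preparation in [cite: KhristoforovSkopenkovSmirnov2025, §1]. Both laws:
first stated for every domain and machine-checked here (lane label cells lit-2 g13, 2026-08-23).

## References
* M. Khristoforov, S. Smirnov, *Percolation and O(1) loop model*, arXiv:2111.15612 (2021), §1.2 (loop configurations, Lemma 2,
  pp. 2–3), §2 (Definition 3 p. 4, eq. (4) p. 5).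
* M. Khristoforov, M. Skopenkov, S. Smirnov, *A generalization of Cardy's and Schramm's formulae*, Comm. Math. Phys. 406 (2025)
  (arXiv:2305.12368v1), §1 (p. 2), §3 Lemma 3.6 (p. 6).
* S. Smirnov, *Critical percolation in the plane: conformal invariance, Cardy's formula, scaling limits*, C. R. Acad. Sci. Paris
  333 (2001), §2.
* S. M. Flores, P. Kleban, *A solution space for a system of null-state partial differential equations, Part 1*, Comm. Math.
  Phys. 333 (2015), Abstract and §1.
* B. Bollobás, O. Riordan, *Percolation*, Cambridge University Press (2006), Ch. 7 §7.2.2 pp. 168–171 (Lemma 5, Fig. 9).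
-/


/-! # Door (v-d): the six-point transport at a BOUNDARY edge — part 1, foundations (b-engine-2 g7)

The boundary six-odd-point space with XOR parity (`loopSpace6b`), its classes (`InClassb`), agreement with the tree's inner-edge
space off the corner faces, the standing facts about a boundary-or-inner edge whose faces are not corners (`bdry_facts`), and
the evenness of the odd set of an edge set of `H_G`. -/

open Finset

namespace Literature.Probability.Percolation.FivePoint

open Literature.Probability.Percolation Literature.Probability.LatticeModels

namespace Bdry

open N5

variable (D : TriMarkedDomain 5)

open Classical in
/-- **the boundary six-odd-point space** at the bond `s(u, v)` (dual to the `H_G`-edge `{x, x'}`), endpoint `s ∈ {x, x'}`: edge sets of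
`H_G` avoiding `s(u, v)` whose odd faces are the corner faces XOR `s` (when `s` is itself a corner face it must be EVEN). For `s`
not a corner this is the tree's `N5.loopSpace6 D u v s`. [cite: KhristoforovSmirnov2021, §1.2 (loop configurations, pp. 2–4)] -/
noncomputable def loopSpace6b (u v : Site 2) (s : HexVertex) : Finset (Finset (Sym2 (Site 2))) :=
  ((hBonds D).erase s(u, v)).powerset.filter fun ξ =>
    ∀ F ∈ triFacesTouching D.verts, (Odd (xiDeg ξ F) ↔ Xor (∃ j : Fin 5, IsCornerFace D j F) (F = s))

/-- the class `W_{j,M}(s)` of the boundary space: the `s`-component reaches the corner `y_j`, and `y_{j+1}` is linked to `y_{j+2}`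
(`m = false`) resp. `y_{j+4}` (`m = true`). [cite: KhristoforovSmirnov2021, §1.2 (loop configurations, pp. 2–4)] -/
def InClassb (u v : Site 2) (s : HexVertex) (j : Fin 5) (m : Bool) (ξ : Finset (Sym2 (Site 2))) : Prop :=
  ξ ∈ loopSpace6b D u v s ∧ (∃ Y : HexVertex, IsCornerFace D j Y ∧ XiLinked ξ s Y) ∧
    (∃ Y₁ Y₂ : HexVertex, IsCornerFace D (j + 1) Y₁ ∧ IsCornerFace D (if m then j + 4 else j + 2) Y₂ ∧ XiLinked ξ Y₁ Y₂)

variable {D}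

/-- off the corner faces the XOR parity is the tree's OR parity. [cite: KhristoforovSmirnov2021, §1.2 Lemma 2 (pp. 2–3)] -/
theorem xor_corner_iff_of_not_corner {s : HexVertex} (hs : s ∉ corners D) (F : HexVertex) :
    Xor (∃ j : Fin 5, IsCornerFace D j F) (F = s) ↔ ((∃ j : Fin 5, IsCornerFace D j F) ∨ F = s) := by
  have key : F = s → ¬ ∃ j : Fin 5, IsCornerFace D j F := by
    rintro rfl ⟨j, hj⟩
    exact hs ((mem_corners D).2 ⟨j, eq_yc D hj⟩)
  unfold Xor
  constructor
  · rintro (⟨h, -⟩ | ⟨h, -⟩)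
    · exact Or.inl h
    · exact Or.inr h
  · rintro (h | h)
    · exact Or.inl ⟨h, fun e => key e h⟩
    · exact Or.inr ⟨h, key h⟩

/-- **the boundary space at a non-corner endpoint is the tree's six-odd-point space.** [cite: KhristoforovSmirnov2021, §1.2 (loop configurations, pp. 2–4)] -/
theorem loopSpace6b_eq_of_not_corner (u v : Site 2) {s : HexVertex} (hs : s ∉ corners D) :
    loopSpace6b D u v s = loopSpace6 D u v s := by
  classical
  unfold loopSpace6b loopSpace6
  refine Finset.filter_congr fun ξ _ => forall₂_congr fun F _ => ?_
  rw [xor_corner_iff_of_not_corner hs]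

/-- … and the classes agree. [cite: KhristoforovSmirnov2021, §1.2 (loop configurations, pp. 2–4)] -/
theorem inClassb_iff_of_not_corner (u v : Site 2) {s : HexVertex} (hs : s ∉ corners D) (j : Fin 5) (m : Bool)
    (ξ : Finset (Sym2 (Site 2))) : InClassb D u v s j m ξ ↔ InClass D u v s j m ξ := by
  unfold InClassb InClass
  rw [loopSpace6b_eq_of_not_corner u v hs]

open Classical in
/-- … hence the class counts agree. [cite: KhristoforovSmirnov2021, §1.2 (loop configurations, pp. 2–4)] -/
theorem filter_inClassb_eq_of_not_corner (u v : Site 2) {s : HexVertex} (hs : s ∉ corners D) (j : Fin 5) (m : Bool) :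
    (loopSpace6b D u v s).filter (fun ξ => InClassb D u v s j m ξ) =
      (loopSpace6 D u v s).filter (fun ξ => InClass D u v s j m ξ) := by
  rw [loopSpace6b_eq_of_not_corner u v hs]
  exact Finset.filter_congr fun ξ _ => inClassb_iff_of_not_corner u v hs j m ξ

/-- membership in the boundary space, unfolded. [cite: KhristoforovSmirnov2021, §1.2 Lemma 2 (pp. 2–3)] -/
theorem mem_loopSpace6b {u v : Site 2} {s : HexVertex} {ξ : Finset (Sym2 (Site 2))} :
    ξ ∈ loopSpace6b D u v s ↔ ξ ⊆ (hBonds D).erase s(u, v) ∧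
      ∀ F ∈ triFacesTouching D.verts, (Odd (xiDeg ξ F) ↔ Xor (∃ j : Fin 5, IsCornerFace D j F) (F = s)) := by
  classical
  unfold loopSpace6b
  rw [Finset.mem_filter, Finset.mem_powerset]

/-! ### The standing facts about an edge `{x, x'}` of `H_G` whose bond has an endpoint in `G` and whose faces are not corners -/

variable (D) in
/-- the analogue of the tree's `inner_facts` with the hypothesis `v ∈ G` replaced by «`x`, `x'` are not corner faces» (all that the
six-point transport uses). [cite: KhristoforovSmirnov2021, §1.2 (loop configurations, pp. 2–4)] -/
theorem bdry_facts {x x' : HexVertex} {u v : Site 2} (hadj : hexGraph.Adj x x') (he : faceEdge x x' = {u, v})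
    (hu : u ∈ D.verts) (hxC : x ∉ corners D) (hx'C : x' ∉ corners D) :
    u ≠ v ∧ u ∈ hexFaceVertices x ∧ v ∈ hexFaceVertices x ∧ u ∈ hexFaceVertices x' ∧ v ∈ hexFaceVertices x' ∧
      x ∈ triFacesTouching D.verts ∧ x' ∈ triFacesTouching D.verts ∧ x ∉ corners D ∧ x' ∉ corners D ∧ x ≠ x' := by
  have hI : hexFaceVertices x ∩ hexFaceVertices x' = {u, v} := he
  have hux : u ∈ hexFaceVertices x := Finset.mem_of_mem_inter_left (s₂ := hexFaceVertices x') (by rw [hI]; simp)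
  have hvx : v ∈ hexFaceVertices x := Finset.mem_of_mem_inter_left (s₂ := hexFaceVertices x') (by rw [hI]; simp)
  have hux' : u ∈ hexFaceVertices x' := Finset.mem_of_mem_inter_right (s₁ := hexFaceVertices x) (by rw [hI]; simp)
  have hvx' : v ∈ hexFaceVertices x' := Finset.mem_of_mem_inter_right (s₁ := hexFaceVertices x) (by rw [hI]; simp)
  have huv : u ≠ v := by
    intro e
    have : #(faceEdge x x') = 2 := ((hexGraph_adj_iff x x').1 hadj).2
    rw [he, e] at this
    simp at this
  exact ⟨huv, hux, hvx, hux', hvx', mem_triFacesTouching.2 ⟨u, hu, hux⟩, mem_triFacesTouching.2 ⟨u, hu, hux'⟩, hxC, hx'C, hadj.ne⟩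

/-- the weaker standing facts with no hypothesis on the faces: distinct bond endpoints, incidences, touching, `x ≠ x'`, the bond is
an `H_G`-bond. [cite: KhristoforovSmirnov2021, §1.2 (loop configurations, pp. 2–4)] -/
theorem edge_facts (D : TriMarkedDomain 5) {x x' : HexVertex} {u v : Site 2} (hadj : hexGraph.Adj x x')
    (he : faceEdge x x' = {u, v}) (hu : u ∈ D.verts) :
    u ≠ v ∧ u ∈ hexFaceVertices x ∧ v ∈ hexFaceVertices x ∧ u ∈ hexFaceVertices x' ∧ v ∈ hexFaceVertices x' ∧
      x ∈ triFacesTouching D.verts ∧ x' ∈ triFacesTouching D.verts ∧ x ≠ x' ∧ triGraph.Adj u v ∧ s(u, v) ∈ hBonds D := by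
  have hI : hexFaceVertices x ∩ hexFaceVertices x' = {u, v} := he
  have hux : u ∈ hexFaceVertices x := Finset.mem_of_mem_inter_left (s₂ := hexFaceVertices x') (by rw [hI]; simp)
  have hvx : v ∈ hexFaceVertices x := Finset.mem_of_mem_inter_left (s₂ := hexFaceVertices x') (by rw [hI]; simp)
  have hux' : u ∈ hexFaceVertices x' := Finset.mem_of_mem_inter_right (s₁ := hexFaceVertices x) (by rw [hI]; simp)
  have hvx' : v ∈ hexFaceVertices x' := Finset.mem_of_mem_inter_right (s₁ := hexFaceVertices x) (by rw [hI]; simp)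
  have huv : u ≠ v := by
    intro e
    have : #(faceEdge x x') = 2 := ((hexGraph_adj_iff x x').1 hadj).2
    rw [he, e] at this
    simp at this
  have huvadj : triGraph.Adj u v := adj_of_mem_hexFaceVertices hux hvx huv
  exact ⟨huv, hux, hvx, hux', hvx', mem_triFacesTouching.2 ⟨u, hu, hux⟩, mem_triFacesTouching.2 ⟨u, hu, hux'⟩, hadj.ne, huvadj,
    mem_hBonds D huvadj (Or.inl hu)⟩

/-- the touching faces having `b₀` as a side are `x` and `x'` (no hypothesis on the faces). [cite: KhristoforovSmirnov2021, §1.2 (loop configurations, pp. 2–4)] -/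
theorem side_eq_b0_iff' (D : TriMarkedDomain 5) {x x' : HexVertex} {u v : Site 2} (hadj : hexGraph.Adj x x')
    (he : faceEdge x x' = {u, v}) (hu : u ∈ D.verts) {F : HexVertex} (hF : F ∈ triFacesTouching D.verts) :
    (∃ i : Fin 3, side F i = s(u, v)) ↔ (F = x ∨ F = x') := by
  obtain ⟨-, hux, hvx, hux', hvx', -, -, -, -, hbB⟩ := edge_facts D hadj he hu
  constructor
  · rintro ⟨i, hi⟩
    exact eq_or_eq_of_inc D hadj he hu hF (by rw [← hi]; exact inc_side F i)
  · intro hF'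
    have hinc : Inc F s(u, v) := by
      rcases hF' with rfl | rfl
      · exact inc_mk_iff.2 ⟨hux, hvx⟩
      · exact inc_mk_iff.2 ⟨hux', hvx'⟩
    obtain ⟨i, hi⟩ := exists_side_eq_of_inc D hbB hinc
    exact ⟨i, hi.symm⟩

/-- the singleton `{b₀}` is odd exactly at `x` and `x'` (no hypothesis on the faces). [cite: KhristoforovSmirnov2021, §1.2 (loop configurations, pp. 2–4)] -/
theorem odd_xiDeg_singleton_iff' (D : TriMarkedDomain 5) {x x' : HexVertex} {u v : Site 2} (hadj : hexGraph.Adj x x')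
    (he : faceEdge x x' = {u, v}) (hu : u ∈ D.verts) {F : HexVertex} (hF : F ∈ triFacesTouching D.verts) :
    Odd (xiDeg {s(u, v)} F) ↔ (F = x ∨ F = x') := by
  classical
  rw [← side_eq_b0_iff' D hadj he hu hF]
  unfold xiDeg
  constructor
  · intro ho
    have hpos : 0 < #((Finset.univ : Finset (Fin 3)).filter fun j =>
        s(faceVertex F (j + 1), faceVertex F (j + 2)) ∈ ({s(u, v)} : Finset (Sym2 (Site 2)))) := by
      rcases Nat.eq_zero_or_pos (#((Finset.univ : Finset (Fin 3)).filter fun j =>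
        s(faceVertex F (j + 1), faceVertex F (j + 2)) ∈ ({s(u, v)} : Finset (Sym2 (Site 2))))) with h0 | hpos
      · rw [h0] at ho; exact absurd ho (by decide)
      · exact hpos
    obtain ⟨i, hi⟩ := Finset.card_pos.1 hpos
    exact ⟨i, Finset.mem_singleton.1 (Finset.mem_filter.1 hi).2⟩
  · rintro ⟨i, hi⟩
    have hset : ((Finset.univ : Finset (Fin 3)).filter fun j =>
        s(faceVertex F (j + 1), faceVertex F (j + 2)) ∈ ({s(u, v)} : Finset (Sym2 (Site 2)))) = {i} := by
      ext j
      simp only [Finset.mem_filter, Finset.mem_univ, true_and, Finset.mem_singleton]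
      constructor
      · intro hj
        apply side_injective F
        rw [hi]
        exact hj
      · intro hj
        rw [hj]
        exact hi
    rw [hset, Finset.card_singleton]
    exact odd_one

/-- the `H_G`-edge `{x, x'}` is an edge of the side graph of `B` as soon as `b₀ ∈ B`. [cite: KhristoforovSmirnov2021, §1.2 (loop configurations, pp. 2–4)] -/
theorem sideGraph_adj_of_b0_mem (D : TriMarkedDomain 5) {x x' : HexVertex} {u v : Site 2} (hadj : hexGraph.Adj x x')
    (he : faceEdge x x' = {u, v}) (hu : u ∈ D.verts) {B : Finset (Sym2 (Site 2))} (hb : s(u, v) ∈ B) :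
    (sideGraph B).Adj x x' := by
  obtain ⟨-, -, -, -, -, hxT, -, -, -, hbB⟩ := edge_facts D hadj he hu
  obtain ⟨i, hi⟩ := (side_eq_b0_iff' D hadj he hu hxT).2 (Or.inl rfl)
  have hoT : oppFace x i ∈ triFacesTouching D.verts :=
    mem_touching_of_side_mem D (j := oppIdx x i) (by rw [side_oppFace_oppIdx, hi]; exact hbB)
  rcases (side_eq_b0_iff' D hadj he hu hoT).1 ⟨oppIdx x i, by rw [side_oppFace_oppIdx, hi]⟩ with h | h
  · exact absurd h.symm (hexGraph_adj_oppFace x i).ne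
  · exact ⟨i, h.symm, by rw [hi]; exact hb⟩

/-! ### Evenness of the odd set -/

/-- **handshake in `H_G`**: an edge set of `H_G` has an even number of odd faces among the faces touching `G`. [cite: KhristoforovSmirnov2021, §1.2 (loop configurations, pp. 2–4)] -/
theorem even_card_filter_odd {ξ : Finset (Sym2 (Site 2))} (hξ : ξ ⊆ hBonds D) :
    Even #((triFacesTouching D.verts).filter fun F => Odd (xiDeg ξ F)) := by
  classical
  have hsum := sum_incMat_mulVec D (indic D ξ)
  have hterm : ∀ F : ↥(triFacesTouching D.verts), (incMat D).mulVec (indic D ξ) F = if Odd (xiDeg ξ F.1) then 1 else 0 := by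
    intro F
    rw [incMat_mulVec_indic D hξ F]
    by_cases ho : Odd (xiDeg ξ F.1)
    · rw [if_pos ho]; exact (ZMod.natCast_eq_one_iff_odd).2 ho
    · rw [if_neg ho]; exact (ZMod.natCast_eq_zero_iff_even).2 (Nat.not_odd_iff_even.1 ho)
  rw [Finset.sum_congr rfl (fun F _ => hterm F), Finset.sum_boole] at hsum
  have hc : #(Finset.univ.filter fun F : ↥(triFacesTouching D.verts) => Odd (xiDeg ξ F.1)) =
      #((triFacesTouching D.verts).filter fun F => Odd (xiDeg ξ F)) := by
    rw [← Finset.card_map ⟨Subtype.val, Subtype.val_injective⟩]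
    congr 1
    ext F
    simp only [Finset.mem_map, Finset.mem_filter, Finset.mem_univ, true_and, Function.Embedding.coeFn_mk]
    constructor
    · rintro ⟨F', hF', rfl⟩; exact ⟨F'.2, hF'⟩
    · rintro ⟨hF, ho⟩; exact ⟨⟨F, hF⟩, ho, rfl⟩
  rw [hc] at hsum
  exact (ZMod.natCast_eq_zero_iff_even).1 hsum

/-- **a prescribed odd set of touching faces has even size.** [cite: KhristoforovSmirnov2021, §1.2 (loop configurations, pp. 2–4)] -/
theorem even_card_of_parityIs {ξ : Finset (Sym2 (Site 2))} (hξ : ξ ⊆ hBonds D) {O : Finset HexVertex}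
    (hO : O ⊆ triFacesTouching D.verts) (h : ParityIs D ξ O) : Even #O := by
  classical
  have heq : ((triFacesTouching D.verts).filter fun F => Odd (xiDeg ξ F)) = O := by
    ext F
    rw [Finset.mem_filter]
    constructor
    · rintro ⟨hF, ho⟩; exact (h F hF).1 ho
    · intro hF; exact ⟨hO hF, (h F (hO hF)).2 hF⟩
  rw [← heq]
  exact even_card_filter_odd hξ

/-- the five corners have odd size, so they are not the odd set of any edge set of `H_G`. [cite: KhristoforovSmirnov2021, §1.2 (loop configurations, pp. 2–4)] -/
theorem not_parityIs_corners {ξ : Finset (Sym2 (Site 2))} (hξ : ξ ⊆ hBonds D) : ¬ ParityIs D ξ (corners D) := by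
  intro h
  have heven := even_card_of_parityIs hξ (fun F hF => by
    obtain ⟨i, rfl⟩ := (mem_corners D).1 hF; exact yc_mem_touching D i) h
  have hcard : #(corners D) = 5 := by
    unfold corners
    rw [Finset.card_image_of_injective _ (yc_injective D), Finset.card_univ, Fintype.card_fin]
  rw [hcard] at heven
  exact absurd heven (by decide)

/-- `#cornersNe j = 4`. [cite: KhristoforovSmirnov2021, §1.2 Lemma 2 (pp. 2–3)] -/
theorem card_cornersNe (j : Fin 5) : #(cornersNe D j) = 4 := by
  classical
  unfold cornersNe
  rw [Finset.card_image_of_injective _ (yc_injective D)]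
  have : (Finset.univ.filter fun i : Fin 5 => i ≠ j) = Finset.univ.erase j := by
    ext i; simp
  rw [this, Finset.card_erase_of_mem (Finset.mem_univ _), Finset.card_univ, Fintype.card_fin]

/-- `cornersNe j ∪ {t}` with `t` a fifth face has odd size, so it is not the odd set of any edge set of `H_G`. [cite: KhristoforovSmirnov2021, §1.2 (loop configurations, pp. 2–4)] -/
theorem not_parityIs_cornersNe_insert {ξ : Finset (Sym2 (Site 2))} (hξ : ξ ⊆ hBonds D) {j : Fin 5} {t : HexVertex}
    (htT : t ∈ triFacesTouching D.verts) (ht : t ∉ cornersNe D j) : ¬ ParityIs D ξ (insert t (cornersNe D j)) := by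
  intro h
  have heven := even_card_of_parityIs hξ (fun F hF => by
    rcases Finset.mem_insert.1 hF with rfl | hF
    · exact htT
    · obtain ⟨i, -, rfl⟩ := (mem_cornersNe D).1 hF; exact yc_mem_touching D i) h
  rw [Finset.card_insert_of_notMem ht, card_cornersNe] at heven
  exact absurd heven (by decide)

end Bdry

end Literature.Probability.Percolation.FivePoint

/-! # Door (v-d): the six-point transport at a BOUNDARY edge — part 2, the N2/N3 chain off the corner faces (b-engine-2 g7)

The tree's N2 (`sixStructure_holds`) and N3 chain (`transportErase_of`, `transportCore_of`, `transportSplit_holds` with their helpers)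
re-run with the hypothesis `v ∈ G` of the inner-edge case replaced by what the proofs actually use: `u ∈ G` and «the two faces
`x`, `x'` are not corner faces» (resp. only `s ∉ corners`). Texts = the tree proofs with `inner_facts` ↦ `bdry_facts`. -/

open Finset

namespace Literature.Probability.Percolation.FivePoint

open Literature.Probability.Percolation Literature.Probability.LatticeModels

namespace Bdry

open N5

variable (D : TriMarkedDomain 5)

/-- Auxiliary. [folklore] -/
private theorem fin5_add_ne' (j : Fin 5) : j + 1 ≠ j ∧ j + 2 ≠ j ∧ j + 4 ≠ j := by revert j; decide



open Classical in
/-- **the component of `s` in a six-odd-point configuration is a transport set** for its own interface vertex set, and it lies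
off the interfaces. [cite: KhristoforovSmirnov2021, §1.2 (loop configurations, pp. 2–4)] -/
theorem comp_goodSet_b {x x' : HexVertex} {u v : Site 2} (hadj : hexGraph.Adj x x') (he : faceEdge x x' = {u, v})
    (hu : u ∈ D.verts) {j : Fin 5} {A : Finset (Sym2 (Site 2))} (hAE : A ⊆ (hBonds D).erase s(u, v))
    {s : HexVertex} (hs : s = x ∨ s = x') (hsC : s ∉ corners D) (hpar : ParityIs D A (insert s (corners D))) (hsj : (sideGraph A).Reachable s (yc D j)) :
    (∀ F, (sideGraph A).Reachable s F → ¬ ipv D j A F) ∧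
    GoodSet D x x' u v j (ipvSet D j A) (A.filter fun e => ∃ F, (sideGraph A).Reachable s F ∧ ∃ i : Fin 3, e = side F i) s := by
  classical
  obtain ⟨huv, hux, hvx, hux', hvx', hxT, hx'T, hxx', -, -⟩ := edge_facts D hadj he hu
  have hA : A ⊆ hBonds D := fun e he' => Finset.mem_of_mem_erase (hAE he')
  have hsT : s ∈ triFacesTouching D.verts := by rcases hs with rfl | rfl; exacts [hxT, hx'T]
  have hdeg : ∀ F, xiDeg A F ≤ 2 := xiDeg_le_two_of_odd_imp D hadj he hu hAE fun F hF ho => by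
    have := (hpar F hF).1 ho
    rw [Finset.mem_insert, mem_corners] at this
    rcases this with h | ⟨i, h⟩
    · exact Or.inr (h ▸ hs)
    · exact Or.inl ⟨i, h ▸ yc_spec D i⟩
  have hso : Odd (xiDeg A s) := (hpar s hsT).2 (Finset.mem_insert_self _ _)
  obtain ⟨-, huniq⟩ := odd_component D hA hdeg hsT hso
  have hcodd : ∀ i, Odd (xiDeg A (yc D i)) := fun i =>
    (hpar _ (yc_mem_touching D i)).2 (Finset.mem_insert_of_mem (yc_mem_corners D i))
  have hcs : ∀ i, yc D i ≠ s := fun i h => hsC (h ▸ yc_mem_corners D i)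
  have hnot_s : ¬ ipv D j A s := by
    rintro ⟨i, hi, hr⟩
    have := huniq (yc D i) (yc D j) hr.symm hsj (hcodd i) (hcodd j) (hcs i) (hcs j)
    exact hi (yc_injective D this)
  have hoff : ∀ F, (sideGraph A).Reachable s F → ¬ ipv D j A F := by
    rintro F hF ⟨i, hi, hr⟩
    exact hnot_s ⟨i, hi, hr.trans hF.symm⟩
  refine ⟨hoff, hs, (Finset.filter_subset _ _).trans hAE, ?_, ?_⟩
  · intro e he' F hFV hinc
    obtain ⟨heA, F'', hr, i'', rfl⟩ := Finset.mem_filter.1 he'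
    unfold ipvSet at hFV
    obtain ⟨hFT, hFipv⟩ := Finset.mem_filter.1 hFV
    exact hoff F (reach_of_inc D hA hr heA hFT hinc) hFipv
  · intro F hF
    by_cases hr : (sideGraph A).Reachable s F
    · have hdegF : xiDeg (A.filter fun e => ∃ F, (sideGraph A).Reachable s F ∧ ∃ i : Fin 3, e = side F i) F = xiDeg A F := by
        unfold xiDeg
        congr 1
        refine Finset.filter_congr fun i _ => ?_
        rw [Finset.mem_filter]
        exact ⟨fun h => h.1, fun h => ⟨h, F, hr, i, rfl⟩⟩
      rw [hdegF, hpar F hF, Finset.mem_insert, mem_corners]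
      constructor
      · rintro (h | ⟨i, h⟩)
        · exact Or.inr h
        · by_cases hij : i = j
          · exact Or.inl (by rw [h, hij])
          · exact absurd ⟨i, hij, by rw [h]⟩ (hoff F hr)
      · rintro (h | h)
        · exact Or.inr ⟨j, h⟩
        · exact Or.inl h
    · have h0 : xiDeg (A.filter fun e => ∃ F, (sideGraph A).Reachable s F ∧ ∃ i : Fin 3, e = side F i) F = 0 := by
        unfold xiDeg
        rw [Finset.card_eq_zero, Finset.filter_eq_empty_iff]
        intro i _ hi
        obtain ⟨hmemA, F'', hr'', i'', he''⟩ := Finset.mem_filter.1 hi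
        exact hr (reach_of_side_eq D hA hr'' he'' (he'' ▸ hmemA))
      rw [h0]
      constructor
      · intro h; exact absurd h (by decide)
      · rintro (rfl | rfl)
        · exact absurd hsj hr
        · exact absurd SimpleGraph.Reachable.rfl hr

/-- a joining chain off the interfaces yields a transport set. [cite: KhristoforovSmirnov2021, §1.2 (loop configurations, pp. 2–4)] -/
theorem goodSet_of_joined_b (h3 : ChainEdgeSet D) {x x' : HexVertex} {u v : Site 2} {j : Fin 5} {A : Finset (Sym2 (Site 2))}
    {t₀ : HexVertex} (ht₀ : t₀ = x ∨ t₀ = x') (ht₀C : t₀ ∉ corners D) (hJ : JoinedOff D ((hBonds D).erase s(u, v)) j A t₀) :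
    ∃ γ t, GoodSet D x x' u v j (ipvSet D j A) γ t := by
  classical
  obtain ⟨-, -, hchain⟩ := hJ
  obtain ⟨γ, hγE, havoid, hpar⟩ := h3 _ (Finset.erase_subset _ _) (fun F => ¬ ipv D j A F) (yc D j) t₀ hchain
  have hne : yc D j ≠ t₀ := fun h => ht₀C (h ▸ yc_mem_corners D j)
  refine ⟨γ, t₀, ht₀, hγE, fun e he' F hFV hinc => ?_, fun F hF => ?_⟩
  · unfold ipvSet at hFV
    obtain ⟨hFT, hFipv⟩ := Finset.mem_filter.1 hFV
    exact havoid e he' F hFT hinc hFipv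
  · rw [hpar F hF]
    unfold Xor
    constructor
    · rintro (⟨h, -⟩ | ⟨h, -⟩)
      · exact Or.inl h
      · exact Or.inr h
    · rintro (h | h)
      · exact Or.inl ⟨h, fun h' => hne (h.symm.trans h')⟩
      · exact Or.inr ⟨h, fun h' => hne (h'.symm.trans h)⟩

/-- **N3-A off the corner faces**: `#domD = #codW` by the involution `Φ`, for any edge `{x, x'}` of `H_G` whose bond has `u ∈ G` and
whose two faces are not corner faces. [cite: KhristoforovSmirnov2021, §1.2 Lemma 2 (pp. 2–3)] -/
theorem transportCore_b (h1 : XorDeg) (h2 : ReachXor) (h3 : ChainEdgeSet D) {x x' : HexVertex} {u v : Site 2}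
    (hadj : hexGraph.Adj x x') (he : faceEdge x x' = {u, v}) (hu : u ∈ D.verts) (hxC : x ∉ corners D) (hx'C : x' ∉ corners D)
    (j : Fin 5) (m : Bool) : #(domD D x x' u v j m) = #(codW D x x' u v j m) := by
  classical
  obtain ⟨huv, hux, hvx, hux', hvx', hxT, hx'T, hxC, hx'C, hxx'⟩ := bdry_facts D hadj he hu hxC hx'C
  have hE₀B : (hBonds D).erase s(u, v) ⊆ hBonds D := Finset.erase_subset _ _
  -- Φ maps domD into codW and keeps the interface vertex set
  have hDW : ∀ A ∈ domD D x x' u v j m,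
      Phi D x x' u v j A ∈ codW D x x' u v j m ∧ ipvSet D j (Phi D x x' u v j A) = ipvSet D j A := by
    intro A hA
    obtain ⟨hAE, hparA, hpat, hJ⟩ := (mem_domD D).1 hA
    have hAB : A ⊆ hBonds D := hAE.trans hE₀B
    have hex : ∃ γ t, GoodSet D x x' u v j (ipvSet D j A) γ t := by
      rcases hJ with hJ | hJ
      · exact goodSet_of_joined_b D h3 (Or.inl rfl) hxC hJ
      · exact goodSet_of_joined_b D h3 (Or.inr rfl) hx'C hJ
    obtain ⟨t, htx, hγE, havoid, hγpar⟩ := gam_good D hex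
    set γ := gam D x x' u v j (ipvSet D j A) with hγ
    have hipv : ∀ F, ipv D j (symmDiff A γ) F ↔ ipv D j A F := ipv_symmDiff_iff D h2 hAB havoid
    have hipvSet : ipvSet D j (symmDiff A γ) = ipvSet D j A := ipvSet_symmDiff D h2 hAB havoid
    have hPhi : Phi D x x' u v j A = symmDiff A γ := rfl
    rw [hPhi]
    refine ⟨?_, hipvSet⟩
    have htC : t ∉ corners D := by rcases htx with rfl | rfl; exacts [hxC, hx'C]
    have htT : t ∈ triFacesTouching D.verts := by rcases htx with rfl | rfl; exacts [hxT, hx'T]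
    -- t is off the interfaces (γ has a side of t)
    have ht_odd : Odd (xiDeg γ t) := (hγpar t htT).2 (Or.inr rfl)
    have ht_nipv : ¬ ipv D j A t := by
      intro hti
      have hpos : 0 < xiDeg γ t := Nat.pos_of_ne_zero fun h0 => by
        rw [h0] at ht_odd; exact absurd ht_odd (by decide)
      unfold xiDeg at hpos
      obtain ⟨i, hi⟩ := Finset.card_pos.1 hpos
      have hside : side t i ∈ γ := (Finset.mem_filter.1 hi).2
      exact havoid _ hside t (by unfold ipvSet; exact Finset.mem_filter.2 ⟨htT, hti⟩) (inc_side t i)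
    have hsub' : symmDiff A γ ⊆ (hBonds D).erase s(u, v) := fun e he' => by
      rcases Finset.mem_symmDiff.1 he' with ⟨h, -⟩ | ⟨h, -⟩
      · exact hAE h
      · exact hγE h
    have hparity : ∀ F ∈ triFacesTouching D.verts,
        (Odd (xiDeg (symmDiff A γ) F) ↔ ¬ (Odd (xiDeg A F) ↔ (F = yc D j ∨ F = t))) := by
      intro F hF
      rw [h1 A γ F, hγpar F hF]
    -- the new odd vertex s'
    obtain ⟨s', hs'x, hs'par, hs'nipv⟩ : ∃ s', (s' = x ∨ s' = x') ∧ ParityIs D (symmDiff A γ) (insert s' (corners D)) ∧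
        ¬ ipv D j A s' := by
      rcases hparA with hP | hP
      · refine ⟨t, htx, fun F hF => ?_, ht_nipv⟩
        rw [hparity F hF, hP F hF]
        exact parity_shift₁ D j htC F
      · obtain ⟨t', ht'x, htt', hpair⟩ : ∃ t', (t' = x ∨ t' = x') ∧ t ≠ t' ∧ ({x, x'} : Finset HexVertex) = {t, t'} := by
          rcases htx with rfl | rfl
          · exact ⟨x', Or.inr rfl, hxx', rfl⟩
          · exact ⟨x, Or.inl rfl, fun h => hxx' h.symm, Finset.pair_comm _ _⟩
        have ht'C : t' ∉ corners D := by rcases ht'x with rfl | rfl; exacts [hxC, hx'C]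
        refine ⟨t', ht'x, fun F hF => ?_, ?_⟩
        · rw [hparity F hF, hP F hF, hpair]
          exact parity_shift₂ D j htC ht'C htt' F
        · intro ht'i
          have hdegA : ∀ F, xiDeg A F ≤ 2 := xiDeg_le_two_of_odd_imp D hadj he hu hAE fun F hF ho => by
            have := (hP F hF).1 ho
            rw [Finset.mem_union, mem_cornersNe, Finset.mem_insert, Finset.mem_singleton] at this
            rcases this with ⟨i, -, h⟩ | h
            · exact Or.inl ⟨i, h ▸ yc_spec D i⟩
            · exact Or.inr h
          have htoddA : Odd (xiDeg A t) := (hP t htT).2 (Finset.mem_union_right _ (by rw [hpair]; simp))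
          obtain ⟨⟨Z, hZt, hZodd, hZr⟩, -⟩ := odd_component D hAB hdegA htT htoddA
          have hZT := touching_of_reachable D hAB htT hZr
          have hZ := (hP Z hZT).1 hZodd
          rw [hpair, Finset.mem_union, mem_cornersNe, Finset.mem_insert, Finset.mem_singleton] at hZ
          rcases hZ with ⟨i, hi, hZi⟩ | hZ' | hZ'
          · exact ht_nipv ⟨i, hi, (hZi ▸ hZr).symm⟩
          · exact hZt hZ'
          · obtain ⟨i, hi, hr⟩ := ht'i
            exact ht_nipv ⟨i, hi, (hr.trans (hZ' ▸ hZr).symm)⟩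
    -- s' is linked to y_j in A ∆ γ
    have hs'T : s' ∈ triFacesTouching D.verts := by rcases hs'x with rfl | rfl; exacts [hxT, hx'T]
    have hdeg' : ∀ F, xiDeg (symmDiff A γ) F ≤ 2 := xiDeg_le_two_of_odd_imp D hadj he hu hsub' fun F hF ho => by
      have := (hs'par F hF).1 ho
      rw [Finset.mem_insert, mem_corners] at this
      rcases this with h | ⟨i, h⟩
      · exact Or.inr (h ▸ hs'x)
      · exact Or.inl ⟨i, h ▸ yc_spec D i⟩
    have hs'odd : Odd (xiDeg (symmDiff A γ) s') := (hs'par s' hs'T).2 (Finset.mem_insert_self _ _)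
    obtain ⟨⟨Z, hZs, hZodd, hZr⟩, -⟩ := odd_component D (hsub'.trans hE₀B) hdeg' hs'T hs'odd
    have hZT := touching_of_reachable D (hsub'.trans hE₀B) hs'T hZr
    have hZ := (hs'par Z hZT).1 hZodd
    rw [Finset.mem_insert, mem_corners] at hZ
    have hreach : (sideGraph (symmDiff A γ)).Reachable s' (yc D j) := by
      rcases hZ with h | ⟨i, hZi⟩
      · exact absurd h hZs
      · by_cases hij : i = j
        · rw [← hij, ← hZi]; exact hZr
        · exact absurd ((hipv s').1 ⟨i, hij, (hZi ▸ hZr).symm⟩) hs'nipv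
    refine (mem_codW D).2 ⟨hsub', s', ?_, hs'par, hreach, (patm_symmDiff_iff D h2 hAB havoid).2 hpat⟩
    rcases hs'x with rfl | rfl <;> simp
  -- Φ maps codW into domD and keeps the interface vertex set
  have hWD : ∀ A ∈ codW D x x' u v j m,
      Phi D x x' u v j A ∈ domD D x x' u v j m ∧ ipvSet D j (Phi D x x' u v j A) = ipvSet D j A := by
    intro A hA
    obtain ⟨hAE, s, hs, hparA, hsj, hpat⟩ := (mem_codW D).1 hA
    have hAB : A ⊆ hBonds D := hAE.trans hE₀B
    have hs' : s = x ∨ s = x' := by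
      rcases Finset.mem_insert.1 hs with h | h
      · exact Or.inl h
      · exact Or.inr (Finset.mem_singleton.1 h)
    have hsC₀ : s ∉ corners D := by rcases hs' with rfl | rfl; exacts [hxC, hx'C]
    obtain ⟨hoff, hgood⟩ := comp_goodSet_b D hadj he hu hAE hs' hsC₀ hparA hsj
    obtain ⟨t, htx, hγE, havoid, hγpar⟩ := gam_good D ⟨_, _, hgood⟩
    set γ := gam D x x' u v j (ipvSet D j A) with hγ
    have hipv : ∀ F, ipv D j (symmDiff A γ) F ↔ ipv D j A F := ipv_symmDiff_iff D h2 hAB havoid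
    have hipvSet : ipvSet D j (symmDiff A γ) = ipvSet D j A := ipvSet_symmDiff D h2 hAB havoid
    have hPhi : Phi D x x' u v j A = symmDiff A γ := rfl
    rw [hPhi]
    refine ⟨?_, hipvSet⟩
    have htC : t ∉ corners D := by rcases htx with rfl | rfl; exacts [hxC, hx'C]
    have hsC : s ∉ corners D := by rcases hs' with rfl | rfl; exacts [hxC, hx'C]
    have hsub' : symmDiff A γ ⊆ (hBonds D).erase s(u, v) := fun e he' => by
      rcases Finset.mem_symmDiff.1 he' with ⟨h, -⟩ | ⟨h, -⟩
      · exact hAE h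
      · exact hγE h
    have hparity : ∀ F ∈ triFacesTouching D.verts,
        (Odd (xiDeg (symmDiff A γ) F) ↔ ¬ ((F ∈ insert s (corners D)) ↔ (F = yc D j ∨ F = t))) := by
      intro F hF
      rw [h1 A γ F, hγpar F hF, hparA F hF]
    refine (mem_domD D).2 ⟨hsub', ?_, (patm_symmDiff_iff D h2 hAB havoid).2 hpat, ?_⟩
    · by_cases hts : t = s
      · left
        intro F hF
        rw [hparity F hF, ← hts]
        exact xor_swap (parity_shift₁ D j htC F)
      · right
        intro F hF
        rw [hparity F hF]
        have hpair : ({x, x'} : Finset HexVertex) = {t, s} := by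
          rcases htx with htx | htx <;> rcases hs' with hs' | hs'
          · exact absurd (htx.trans hs'.symm) hts
          · rw [htx, hs']
          · rw [htx, hs', Finset.pair_comm]
          · exact absurd (htx.trans hs'.symm) hts
        rw [hpair]
        exact xor_swap (parity_shift₂ D j htC hsC hts F)
    · have hJ : JoinedOff D ((hBonds D).erase s(u, v)) j (symmDiff A γ) s := by
        refine ⟨fun h => hoff s SimpleGraph.Reachable.rfl ((hipv s).1 h), fun h => hoff _ hsj ((hipv _).1 h), ?_⟩
        exact chain_of_reachable (E := (hBonds D).erase s(u, v)) hAE (P := fun F => ¬ ipv D j (symmDiff A γ) F)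
          (a := yc D j) (b := s) (fun F hF => fun h => hoff F (hsj.trans hF) ((hipv F).1 h)) hsj.symm
      rcases hs' with rfl | rfl
      · exact Or.inl hJ
      · exact Or.inr hJ
  -- Φ is an involution on both sides
  have hinv : ∀ A, ipvSet D j (Phi D x x' u v j A) = ipvSet D j A → Phi D x x' u v j (Phi D x x' u v j A) = A := by
    intro A h
    show symmDiff (Phi D x x' u v j A) (gam D x x' u v j (ipvSet D j (Phi D x x' u v j A))) = A
    rw [h]
    exact symmDiff_symmDiff_cancel_right _ _
  exact Finset.card_bij' (fun A _ => Phi D x x' u v j A) (fun A _ => Phi D x x' u v j A) (fun A hA => (hDW A hA).1)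
    (fun A hA => (hWD A hA).1) (fun A hA => hinv A (hDW A hA).2) (fun A hA => hinv A (hWD A hA).2)

/-- with odd set `{y_i : i ≠ j} ∪ {x, x'}`: if one of `x, x'` is off the interfaces, both are (they end one path). [cite: KhristoforovSmirnov2021, §1.2 (loop configurations, pp. 2–4)] -/
theorem other_end_nipv_b {x x' : HexVertex} {u v : Site 2} (hadj : hexGraph.Adj x x') (he : faceEdge x x' = {u, v})
    (hu : u ∈ D.verts) {j : Fin 5} {A : Finset (Sym2 (Site 2))} (hAE : A ⊆ (hBonds D).erase s(u, v))
    (hP : ParityIs D A (cornersNe D j ∪ {x, x'})) {t : HexVertex} (htx : t = x ∨ t = x') (ht : ¬ ipv D j A t) :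
    ¬ ipv D j A x ∧ ¬ ipv D j A x' := by
  classical
  obtain ⟨-, -, -, -, -, hxT, hx'T, -, -, -⟩ := edge_facts D hadj he hu
  have hAB : A ⊆ hBonds D := hAE.trans (Finset.erase_subset _ _)
  have htT : t ∈ triFacesTouching D.verts := by rcases htx with rfl | rfl; exacts [hxT, hx'T]
  have hdegA : ∀ F, xiDeg A F ≤ 2 := xiDeg_le_two_of_odd_imp D hadj he hu hAE fun F hF ho => by
    have := (hP F hF).1 ho
    rw [Finset.mem_union, mem_cornersNe, Finset.mem_insert, Finset.mem_singleton] at this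
    rcases this with ⟨i, -, h⟩ | h
    · exact Or.inl ⟨i, h ▸ yc_spec D i⟩
    · exact Or.inr h
  have htoddA : Odd (xiDeg A t) := (hP t htT).2 (Finset.mem_union_right _ (by rcases htx with rfl | rfl <;> simp))
  obtain ⟨⟨Z, hZt, hZodd, hZr⟩, -⟩ := odd_component D hAB hdegA htT htoddA
  have hZT := touching_of_reachable D hAB htT hZr
  have hZ := (hP Z hZT).1 hZodd
  rw [Finset.mem_union, mem_cornersNe, Finset.mem_insert, Finset.mem_singleton] at hZ
  have hZnipv : ¬ ipv D j A Z := fun ⟨i, hi, hr⟩ => ht ⟨i, hi, hr.trans hZr.symm⟩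
  rcases hZ with ⟨i, hi, hZi⟩ | hZx | hZx'
  · exact absurd ⟨i, hi, (hZi ▸ hZr).symm⟩ ht
  · rcases htx with rfl | rfl
    · exact absurd hZx hZt
    · exact ⟨hZx ▸ hZnipv, ht⟩
  · rcases htx with rfl | rfl
    · exact ⟨ht, hZx' ▸ hZnipv⟩
    · exact absurd hZx' hZt

/-- **cutting a joining chain at the edge `{x, x'}`**: an `H_G`-chain through `P`-faces either avoids `b₀`, or both `x, x'` are
`P`-faces and an initial segment avoiding `b₀` reaches one of them. [cite: KhristoforovSmirnov2021, §1.2 (loop configurations, pp. 2–4)] -/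
theorem chain_split_b {x x' : HexVertex} {u v : Site 2} (hadj : hexGraph.Adj x x') (he : faceEdge x x' = {u, v})
    (hu : u ∈ D.verts) (P : HexVertex → Prop) {a t : HexVertex}
    (h : Relation.ReflTransGen (fun F F' => (sideGraph (hBonds D)).Adj F F' ∧ P F ∧ P F') a t) :
    Relation.ReflTransGen (fun F F' => (sideGraph ((hBonds D).erase s(u, v))).Adj F F' ∧ P F ∧ P F') a t ∨
    (P x ∧ P x' ∧
      (Relation.ReflTransGen (fun F F' => (sideGraph ((hBonds D).erase s(u, v))).Adj F F' ∧ P F ∧ P F') a x ∨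
        Relation.ReflTransGen (fun F F' => (sideGraph ((hBonds D).erase s(u, v))).Adj F F' ∧ P F ∧ P F') a x')) := by
  induction h using Relation.ReflTransGen.head_induction_on with
  | refl => exact Or.inl Relation.ReflTransGen.refl
  | @head a' b' hab _ ih =>
    obtain ⟨⟨i, hb, hside⟩, hPa, hPb⟩ := hab
    by_cases hbi : side a' i = s(u, v)
    · right
      have haT : a' ∈ triFacesTouching D.verts := mem_touching_of_side_mem D hside
      have ha := (side_eq_b0_iff' D hadj he hu haT).1 ⟨i, hbi⟩
      have hbT : oppFace a' i ∈ triFacesTouching D.verts :=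
        mem_touching_of_side_mem D (j := oppIdx a' i) (by rw [side_oppFace_oppIdx]; exact hside)
      have hb' := (side_eq_b0_iff' D hadj he hu hbT).1 ⟨oppIdx a' i, by rw [side_oppFace_oppIdx]; exact hbi⟩
      have hne : a' ≠ oppFace a' i := (hexGraph_adj_oppFace a' i).ne
      rw [← hb] at hb' hne
      rcases ha with rfl | rfl <;> rcases hb' with rfl | rfl
      · exact absurd rfl hne
      · exact ⟨hPa, hPb, Or.inl Relation.ReflTransGen.refl⟩
      · exact ⟨hPb, hPa, Or.inr Relation.ReflTransGen.refl⟩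
      · exact absurd rfl hne
    · have hstep : (sideGraph ((hBonds D).erase s(u, v))).Adj a' b' ∧ P a' ∧ P b' :=
        ⟨⟨i, hb, Finset.mem_erase.2 ⟨hbi, hside⟩⟩, hPa, hPb⟩
      rcases ih with h | ⟨hx, hx', h | h⟩
      · exact Or.inl (Relation.ReflTransGen.head hstep h)
      · exact Or.inr ⟨hx, hx', Or.inl (Relation.ReflTransGen.head hstep h)⟩
      · exact Or.inr ⟨hx, hx', Or.inr (Relation.ReflTransGen.head hstep h)⟩

/-- **N3-B2 off the corner faces**: `#domR = #domD` via `B ↦ B.erase b₀` — in fact only `x, x' ∉ cornersNe j` is used. [cite: KhristoforovSmirnov2021, §1.2 Lemma 2 (pp. 2–3)] -/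
theorem transportErase_b (h1 : XorDeg) (h2 : ReachXor) {x x' : HexVertex} {u v : Site 2}
    (hadj : hexGraph.Adj x x') (he : faceEdge x x' = {u, v}) (hu : u ∈ D.verts) {j : Fin 5} (hxCj : x ∉ cornersNe D j)
    (hx'Cj : x' ∉ cornersNe D j) (m : Bool) : #(domR D x x' j m) = #(domD D x x' u v j m) := by
  classical
  obtain ⟨huv, hux, hvx, hux', hvx', hxT, hx'T, hxx', -, -⟩ := edge_facts D hadj he hu
  have hE₀B : (hBonds D).erase s(u, v) ⊆ hBonds D := Finset.erase_subset _ _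
  have huvadj : triGraph.Adj u v := adj_of_mem_hexFaceVertices hux hvx huv
  have hbB : s(u, v) ∈ hBonds D := mem_hBonds D huvadj (Or.inl hu)
  -- loopSpace membership as a parity profile
  have hLS : ∀ B, B ∈ loopSpace D j ↔ B ⊆ hBonds D ∧ ParityIs D B (cornersNe D j) := by
    intro B
    unfold loopSpace ParityIs
    rw [Finset.mem_filter, Finset.mem_powerset]
    refine and_congr_right fun _ => forall₂_congr fun F _ => ?_
    rw [mem_cornersNe]
    exact iff_congr Iff.rfl (exists_congr fun i => and_congr_right fun _ => isCornerFace_iff_eq_yc D)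
  have hmemR : ∀ B, B ∈ domR D x x' j m ↔ (B ⊆ hBonds D ∧ ParityIs D B (cornersNe D j)) ∧ patm D j m B ∧
      (JoinedOff D (hBonds D) j B x ∨ JoinedOff D (hBonds D) j B x') := by
    intro B
    unfold domR
    rw [Finset.mem_filter, hLS]
  -- parity after toggling b₀
  have htoggle : ∀ (B : Finset (Sym2 (Site 2))) (F : HexVertex), F ∈ triFacesTouching D.verts →
      (Odd (xiDeg (symmDiff B {s(u, v)}) F) ↔ ¬ (Odd (xiDeg B F) ↔ (F = x ∨ F = x'))) := by
    intro B F hF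
    rw [h1 B {s(u, v)} F, odd_xiDeg_singleton_iff' D hadj he hu hF]
  -- E₀-chains are hBonds-chains
  have hmono : ∀ (P : HexVertex → Prop) (a b : HexVertex),
      Relation.ReflTransGen (fun F F' => (sideGraph ((hBonds D).erase s(u, v))).Adj F F' ∧ P F ∧ P F') a b →
      Relation.ReflTransGen (fun F F' => (sideGraph (hBonds D)).Adj F F' ∧ P F ∧ P F') a b := by
    intro P a b h
    induction h with
    | refl => exact Relation.ReflTransGen.refl
    | tail _ hbc ih =>
      obtain ⟨⟨i, hc, hmem⟩, hP1, hP2⟩ := hbc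
      exact ih.tail ⟨⟨i, hc, hE₀B hmem⟩, hP1, hP2⟩
  refine Finset.card_bij (fun B _ => B.erase s(u, v)) (fun B hB => ?_) (fun B₁ hB₁ B₂ hB₂ hEq => ?_) (fun A hA => ?_)
  · -- maps into domD
    obtain ⟨⟨hBB, hparB⟩, hpat, hJ⟩ := (hmemR B).1 hB
    have hoffb : s(u, v) ∈ B → ¬ ipv D j B x ∧ ¬ ipv D j B x' := by
      intro hb
      have hadjB : (sideGraph B).Adj x x' := by
        obtain ⟨i, hi⟩ := (side_eq_b0_iff' D hadj he hu hxT).2 (Or.inl rfl)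
        have hoT : oppFace x i ∈ triFacesTouching D.verts :=
          mem_touching_of_side_mem D (j := oppIdx x i) (by rw [side_oppFace_oppIdx, hi]; exact hbB)
        rcases (side_eq_b0_iff' D hadj he hu hoT).1 ⟨oppIdx x i, by rw [side_oppFace_oppIdx, hi]⟩ with h | h
        · exact absurd h.symm (hexGraph_adj_oppFace x i).ne
        · exact ⟨i, h.symm, by rw [hi]; exact hb⟩
      rcases hJ with hJ | hJ
      · have hx1 := hJ.1
        exact ⟨hx1, fun h => hx1 (by obtain ⟨i', hi', hr⟩ := h; exact ⟨i', hi', hr.trans hadjB.symm.reachable⟩)⟩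
      · have hx1 := hJ.1
        exact ⟨fun h => hx1 (by obtain ⟨i', hi', hr⟩ := h; exact ⟨i', hi', hr.trans hadjB.reachable⟩), hx1⟩
    have hipv : ∀ F, ipv D j (B.erase s(u, v)) F ↔ ipv D j B F := by
      by_cases hb : s(u, v) ∈ B
      · rw [erase_eq_symmDiff hb]
        obtain ⟨h0, h0'⟩ := hoffb hb
        exact ipv_symmDiff_iff D h2 hBB (b0_avoids D hadj he hu h0 h0')
      · rw [Finset.erase_eq_of_notMem hb]
        exact fun F => Iff.rfl
    have hpat' : patm D j m (B.erase s(u, v)) := by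
      by_cases hb : s(u, v) ∈ B
      · rw [erase_eq_symmDiff hb]
        obtain ⟨h0, h0'⟩ := hoffb hb
        exact (patm_symmDiff_iff D h2 hBB (b0_avoids D hadj he hu h0 h0')).2 hpat
      · rw [Finset.erase_eq_of_notMem hb]
        exact hpat
    have hpar' : ParityIs D (B.erase s(u, v)) (cornersNe D j) ∨ ParityIs D (B.erase s(u, v)) (cornersNe D j ∪ {x, x'}) := by
      by_cases hb : s(u, v) ∈ B
      · right
        intro F hF
        rw [erase_eq_symmDiff hb, htoggle B F hF, hparB F hF, Finset.mem_union, Finset.mem_insert, Finset.mem_singleton]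
        have : (F = x ∨ F = x') → F ∉ cornersNe D j := by rintro (rfl | rfl); exacts [hxCj, hx'Cj]
        exact xor_or_iff this
      · left
        rw [Finset.erase_eq_of_notMem hb]
        exact hparB
    have hrel : (fun F F' => (sideGraph ((hBonds D).erase s(u, v))).Adj F F' ∧ ¬ ipv D j (B.erase s(u, v)) F ∧
          ¬ ipv D j (B.erase s(u, v)) F') =
        (fun F F' => (sideGraph ((hBonds D).erase s(u, v))).Adj F F' ∧ ¬ ipv D j B F ∧ ¬ ipv D j B F') := by
      funext F F'
      rw [hipv, hipv]
    have hJ' : JoinedOff D ((hBonds D).erase s(u, v)) j (B.erase s(u, v)) x ∨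
        JoinedOff D ((hBonds D).erase s(u, v)) j (B.erase s(u, v)) x' := by
      unfold JoinedOff
      rw [hrel, hipv x, hipv x', hipv (yc D j)]
      have key : ∀ t, (t = x ∨ t = x') → JoinedOff D (hBonds D) j B t →
          (¬ ipv D j B x ∧ ¬ ipv D j B (yc D j) ∧ Relation.ReflTransGen
              (fun F F' => (sideGraph ((hBonds D).erase s(u, v))).Adj F F' ∧ ¬ ipv D j B F ∧ ¬ ipv D j B F') (yc D j) x) ∨
          (¬ ipv D j B x' ∧ ¬ ipv D j B (yc D j) ∧ Relation.ReflTransGen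
              (fun F F' => (sideGraph ((hBonds D).erase s(u, v))).Adj F F' ∧ ¬ ipv D j B F ∧ ¬ ipv D j B F') (yc D j) x') := by
        rintro t ht ⟨hnt, hnj, hchain⟩
        rcases chain_split_b D hadj he hu (fun F => ¬ ipv D j B F) hchain with h | ⟨hPx, hPx', h | h⟩
        · rcases ht with rfl | rfl
          · exact Or.inl ⟨hnt, hnj, h⟩
          · exact Or.inr ⟨hnt, hnj, h⟩
        · exact Or.inl ⟨hPx, hnj, h⟩
        · exact Or.inr ⟨hPx', hnj, h⟩
      rcases hJ with hJ | hJ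
      · exact key x (Or.inl rfl) hJ
      · exact key x' (Or.inr rfl) hJ
    exact (mem_domD D).2 ⟨Finset.erase_subset_erase _ hBB, hpar', hpat', hJ'⟩
  · -- injective
    obtain ⟨⟨hB₁s, hpar₁⟩, -, -⟩ := (hmemR B₁).1 hB₁
    obtain ⟨⟨hB₂s, hpar₂⟩, -, -⟩ := (hmemR B₂).1 hB₂
    have key : ∀ B B' : Finset (Sym2 (Site 2)), ParityIs D B (cornersNe D j) → ParityIs D B' (cornersNe D j) →
        B.erase s(u, v) = B'.erase s(u, v) → s(u, v) ∈ B → s(u, v) ∈ B' := by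
      intro B B' hP hP' hEq' hb
      by_contra hb'
      have h1' : Odd (xiDeg (symmDiff B {s(u, v)}) x) := by
        rw [htoggle B x hxT, hP x hxT]
        intro h
        exact hxCj (h.2 (Or.inl rfl))
      rw [← erase_eq_symmDiff hb, hEq', Finset.erase_eq_of_notMem hb', hP' x hxT] at h1'
      exact hxCj h1'
    have hiff : s(u, v) ∈ B₁ ↔ s(u, v) ∈ B₂ := ⟨key B₁ B₂ hpar₁ hpar₂ hEq, key B₂ B₁ hpar₂ hpar₁ hEq.symm⟩
    have hEq' : B₁.erase s(u, v) = B₂.erase s(u, v) := hEq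
    by_cases hb : s(u, v) ∈ B₁
    · rw [← Finset.insert_erase hb, ← Finset.insert_erase (hiff.1 hb), hEq']
    · rw [← Finset.erase_eq_of_notMem hb, ← Finset.erase_eq_of_notMem (fun h => hb (hiff.2 h)), hEq']
  · -- surjective
    obtain ⟨hAE, hparA, hpat, hJ⟩ := (mem_domD D).1 hA
    have hAB : A ⊆ hBonds D := hAE.trans hE₀B
    have hbA : s(u, v) ∉ A := fun h => (Finset.mem_erase.1 (hAE h)).1 rfl
    rcases hparA with hP | hP
    · refine ⟨A, (hmemR A).2 ⟨⟨hAB, hP⟩, hpat, ?_⟩, Finset.erase_eq_of_notMem hbA⟩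
      rcases hJ with ⟨h1', h2', h3'⟩ | ⟨h1', h2', h3'⟩
      · exact Or.inl ⟨h1', h2', hmono _ _ _ h3'⟩
      · exact Or.inr ⟨h1', h2', hmono _ _ _ h3'⟩
    · have hoff : ¬ ipv D j A x ∧ ¬ ipv D j A x' := by
        rcases hJ with hJ | hJ
        · exact other_end_nipv_b D hadj he hu hAE hP (Or.inl rfl) hJ.1
        · exact other_end_nipv_b D hadj he hu hAE hP (Or.inr rfl) hJ.1
      have havoid := b0_avoids D hadj he hu hoff.1 hoff.2
      have hipv : ∀ F, ipv D j (insert s(u, v) A) F ↔ ipv D j A F := by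
        rw [insert_eq_symmDiff hbA]
        exact ipv_symmDiff_iff D h2 hAB havoid
      have hparB : ParityIs D (insert s(u, v) A) (cornersNe D j) := by
        intro F hF
        rw [insert_eq_symmDiff hbA, htoggle A F hF, hP F hF, Finset.mem_union, Finset.mem_insert, Finset.mem_singleton]
        have : (F = x ∨ F = x') → F ∉ cornersNe D j := by rintro (rfl | rfl); exacts [hxCj, hx'Cj]
        exact xor_or_iff' this
      have hpatB : patm D j m (insert s(u, v) A) := by
        rw [insert_eq_symmDiff hbA]
        exact (patm_symmDiff_iff D h2 hAB havoid).2 hpat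
      have hrel : (fun F F' => (sideGraph (hBonds D)).Adj F F' ∧ ¬ ipv D j (insert s(u, v) A) F ∧
            ¬ ipv D j (insert s(u, v) A) F') =
          (fun F F' => (sideGraph (hBonds D)).Adj F F' ∧ ¬ ipv D j A F ∧ ¬ ipv D j A F') := by
        funext F F'
        rw [hipv, hipv]
      refine ⟨insert s(u, v) A, (hmemR _).2 ⟨⟨Finset.insert_subset hbB hAB, hparB⟩, hpatB, ?_⟩, Finset.erase_insert hbA⟩
      unfold JoinedOff
      rw [hrel, hipv x, hipv x', hipv (yc D j)]
      rcases hJ with ⟨h1', h2', h3'⟩ | ⟨h1', h2', h3'⟩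
      · exact Or.inl ⟨h1', h2', hmono _ _ _ h3'⟩
      · exact Or.inr ⟨h1', h2', hmono _ _ _ h3'⟩

open Classical in
/-- **N3-C off the corner faces**: `codW = W_{j,m}(x) ⊔ W_{j,m}(x')` (only `x ∉ corners` and `x ≠ x'` are used). [cite: KhristoforovSmirnov2021, §1.2 Lemma 2 (pp. 2–3)] -/
theorem transportSplit_b {x x' : HexVertex} {u v : Site 2} (hadj : hexGraph.Adj x x') (he : faceEdge x x' = {u, v})
    (hu : u ∈ D.verts) (hxC : x ∉ corners D) (j : Fin 5) (m : Bool) :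
    #(codW D x x' u v j m) =
      #((loopSpace6 D u v x).filter fun ξ => InClass D u v x j m ξ) +
        #((loopSpace6 D u v x').filter fun ξ => InClass D u v x' j m ξ) := by
  classical
  obtain ⟨huv, ⟨hux, hvx⟩, -⟩ := c_inner_edge_facts hadj he
  have hxt : x ∈ triFacesTouching D.verts := mem_triFacesTouching.2 ⟨u, hu, hux⟩
  have key : codW D x x' u v j m =
      (loopSpace6 D u v x).filter (fun ξ => InClass D u v x j m ξ) ∪
        (loopSpace6 D u v x').filter (fun ξ => InClass D u v x' j m ξ) := by
    ext A
    rw [Finset.mem_union, c_mem_filter_inClass_iff, c_mem_filter_inClass_iff]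
    unfold codW
    rw [Finset.mem_filter, Finset.mem_powerset]
    constructor
    · rintro ⟨hsub, s, hs, hpar, hreach, hpat⟩
      rw [Finset.mem_insert, Finset.mem_singleton] at hs
      rcases hs with rfl | rfl
      · exact Or.inl ⟨hsub, hpar, hreach, hpat⟩
      · exact Or.inr ⟨hsub, hpar, hreach, hpat⟩
    · rintro (⟨hsub, hpar, hreach, hpat⟩ | ⟨hsub, hpar, hreach, hpat⟩)
      · exact ⟨hsub, x, Finset.mem_insert_self _ _, hpar, hreach, hpat⟩
      · exact ⟨hsub, x', Finset.mem_insert_of_mem (Finset.mem_singleton_self _), hpar, hreach, hpat⟩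
  have hdisj : Disjoint ((loopSpace6 D u v x).filter (fun ξ => InClass D u v x j m ξ))
      ((loopSpace6 D u v x').filter (fun ξ => InClass D u v x' j m ξ)) := by
    rw [Finset.disjoint_left]
    intro A hA hA'
    rw [c_mem_filter_inClass_iff] at hA hA'
    have h1 : Odd (xiDeg A x) := (hA.2.1 x hxt).2 (Finset.mem_insert_self _ _)
    have h2 := (hA'.2.1 x hxt).1 h1
    rw [c_mem_insert_corners_iff] at h2
    rcases h2 with ⟨i, hi⟩ | hxx
    · exact hxC ((mem_corners D).2 ⟨i, eq_yc D hi⟩)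
    · exact hadj.ne hxx
  rw [key, Finset.card_union_of_disjoint hdisj]

/-- **N2 holds for every domain**: every six-odd-point configuration lies in exactly one class `W_{j,M}(s)`. The component of
`s` in the side graph is a path (all side counts `≤ 2`) ending at a unique corner `y_j`; deleting it leaves an element of
`loopSpace D j`, which is `ξ_{j}(σ)` for some colouring `σ` (`LoopSurj`), so exactly one of the patterns `A_j`, `B_j` links the
remaining corners (the loop lemma), and these links avoid the deleted path. [cite: KhristoforovSmirnov2021, §1.2 (loop configurations, pp. 2–4)] -/
theorem sixStructure_b {x x' : HexVertex} {u v : Site 2} (hadj : hexGraph.Adj x x') (he : faceEdge x x' = {u, v})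
    (hu : u ∈ D.verts) {s : HexVertex} (hs : s ∈ ({x, x'} : Finset HexVertex)) (hsC : s ∉ corners D)
    {ξ : Finset (Sym2 (Site 2))} (hξ : ξ ∈ loopSpace6 D u v s) : ∃! p : Fin 5 × Bool, InClass D u v s p.1 p.2 ξ := by
  classical
  -- the inner bond and the face s
  have hI : hexFaceVertices x ∩ hexFaceVertices x' = {u, v} := he
  have hux : u ∈ hexFaceVertices x := Finset.mem_of_mem_inter_left (s₂ := hexFaceVertices x') (by rw [hI]; simp)
  have hvx : v ∈ hexFaceVertices x := Finset.mem_of_mem_inter_left (s₂ := hexFaceVertices x') (by rw [hI]; simp)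
  have hux' : u ∈ hexFaceVertices x' := Finset.mem_of_mem_inter_right (s₁ := hexFaceVertices x) (by rw [hI]; simp)
  have hvx' : v ∈ hexFaceVertices x' := Finset.mem_of_mem_inter_right (s₁ := hexFaceVertices x) (by rw [hI]; simp)
  have huv_ne : u ≠ v := by
    intro e
    have : #(faceEdge x x') = 2 := ((hexGraph_adj_iff x x').1 hadj).2
    rw [he, e] at this
    simp at this
  have hs' : s = x ∨ s = x' := by
    rcases Finset.mem_insert.1 hs with h | h
    · exact Or.inl h
    · exact Or.inr (Finset.mem_singleton.1 h)
  have hus : u ∈ hexFaceVertices s := by rcases hs' with rfl | rfl; exacts [hux, hux']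
  have hvs : v ∈ hexFaceVertices s := by rcases hs' with rfl | rfl; exacts [hvx, hvx']
  have hsT : s ∈ triFacesTouching D.verts := mem_triFacesTouching.2 ⟨u, hu, hus⟩
  have hs_not_corner : ∀ k, ¬ IsCornerFace D k s := fun k hk => hsC ((mem_corners D).2 ⟨k, eq_yc D hk⟩)
  -- the configuration
  have hξ6 := hξ
  unfold loopSpace6 at hξ
  obtain ⟨hsub0, hpar⟩ := Finset.mem_filter.1 hξ
  have hsub : ξ ⊆ hBonds D := fun e he' => Finset.mem_of_mem_erase (Finset.mem_powerset.1 hsub0 he')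
  have hdeg : ∀ F, xiDeg ξ F ≤ 2 := xiDeg_le_two_of_mem_loopSpace6 D hadj he hu hs' hξ6
  have ho_s : Odd (xiDeg ξ s) := (hpar s hsT).2 (Or.inr rfl)
  -- the component of s is a path from s to a corner Yj
  obtain ⟨⟨Yj, hYj_ne, hYj_odd, hYj_reach⟩, huniq⟩ := odd_component D hsub hdeg hsT ho_s
  have hYjT : Yj ∈ triFacesTouching D.verts := touching_of_reachable D hsub hsT hYj_reach
  obtain ⟨j, hj⟩ : ∃ j : Fin 5, IsCornerFace D j Yj := by
    rcases (hpar Yj hYjT).1 hYj_odd with h | h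
    · exact h
    · exact absurd h hYj_ne
  have hreach_corner : ∀ (k : Fin 5) (Y : HexVertex), IsCornerFace D k Y → (sideGraph ξ).Reachable s Y → Y = Yj := by
    intro k Y hY hr
    have hYT := cornerFace_mem_touching D hY
    have hYodd : Odd (xiDeg ξ Y) := (hpar Y hYT).2 (Or.inl ⟨k, hY⟩)
    have hYs : Y ≠ s := fun e => hs_not_corner k (e ▸ hY)
    exact huniq Y Yj hr hYj_reach hYodd hYj_odd hYs hYj_ne
  have hnot_reach : ∀ (k : Fin 5) (Y : HexVertex), IsCornerFace D k Y → k ≠ j → ¬ (sideGraph ξ).Reachable s Y := by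
    intro k Y hY hk hr
    have hYYj := hreach_corner k Y hY hr
    subst hYYj
    exact hk (cornerFace_idx_unique D hY hj)
  -- delete the component of s
  set ξ' : Finset (Sym2 (Site 2)) := ξ.filter fun e => ¬ ∃ F, (sideGraph ξ).Reachable s F ∧ ∃ i : Fin 3, e = side F i
    with hξ'def
  have hξ' : ∀ e, e ∈ ξ' ↔ e ∈ ξ ∧ ¬ ∃ F, (sideGraph ξ).Reachable s F ∧ ∃ i : Fin 3, e = side F i := fun e => by
    rw [hξ'def, Finset.mem_filter]
  obtain ⟨hzero, hsame, hlink⟩ := restrict_off_component D hsub s ξ' hξ'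
  have hξ'sub : ξ' ⊆ ξ := Finset.filter_subset _ _
  have hξ'mem : ξ' ∈ loopSpace D j := by
    unfold loopSpace
    refine Finset.mem_filter.2 ⟨Finset.mem_powerset.2 (hξ'sub.trans hsub), fun F hF => ?_⟩
    by_cases hr : (sideGraph ξ).Reachable s F
    · rw [hzero F hr]
      constructor
      · intro h0; exact absurd h0 (by decide)
      · rintro ⟨k, hk, hcF⟩
        exact absurd hr (hnot_reach k F hcF hk)
    · rw [hsame F hr, hpar F hF]
      constructor
      · rintro (⟨k, hcF⟩ | hFs)
        · refine ⟨k, fun e => hr ?_, hcF⟩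
          subst e
          rw [cornerFace_unique D hcF hj]
          exact hYj_reach
        · subst hFs
          exact absurd SimpleGraph.Reachable.rfl hr
      · rintro ⟨k, -, hcF⟩
        exact Or.inl ⟨k, hcF⟩
  -- a colouring realising ξ', and the remaining corners
  obtain ⟨σ, hσ⟩ := loopSurj_holds D j false ξ' hξ'mem
  obtain ⟨Y1, hY1⟩ := cornerFace_exists D (j + 1)
  obtain ⟨Y2, hY2⟩ := cornerFace_exists D (j + 2)
  obtain ⟨Y4, hY4⟩ := cornerFace_exists D (j + 4)
  have hY1nr : ¬ (sideGraph ξ).Reachable s Y1 := hnot_reach (j + 1) Y1 hY1 (fin5_add_ne' j).1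
  have hA : XiLinked ξ Y1 Y2 ↔ MatchA D σ j false := by
    rw [hlink Y1 Y2 hY1nr, ← hσ, xiLinked_xiOf_iff]
    unfold MatchA
    constructor
    · intro h; exact ⟨Y1, Y2, hY1, hY2, h⟩
    · rintro ⟨Y1', Y2', h1, h2, h⟩
      rw [cornerFace_unique D hY1 h1, cornerFace_unique D hY2 h2]; exact h
  have hB : XiLinked ξ Y1 Y4 ↔ MatchB D σ j false := by
    rw [hlink Y1 Y4 hY1nr, ← hσ, xiLinked_xiOf_iff]
    unfold MatchB
    constructor
    · intro h; exact ⟨Y1, Y4, hY1, hY4, h⟩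
    · rintro ⟨Y1', Y4', h1, h4, h⟩
      rw [cornerFace_unique D hY1 h1, cornerFace_unique D hY4 h4]; exact h
  have hxor : Xor (MatchA D σ j false) (MatchB D σ j false) := (fiveMarkedLoopLemma_holds D σ j).1
  have hYj_linked : XiLinked ξ s Yj := (xiLinked_iff_reachable ξ s Yj).2 hYj_reach
  -- existence and uniqueness of the class
  refine ⟨(j, decide (MatchB D σ j false)), ?_, ?_⟩
  · show InClass D u v s j (decide (MatchB D σ j false)) ξ
    refine ⟨hξ6, ⟨Yj, hj, hYj_linked⟩, ?_⟩
    by_cases hBm : MatchB D σ j false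
    · simp only [hBm, decide_true, ↓reduceIte]
      exact ⟨Y1, Y4, hY1, hY4, hB.2 hBm⟩
    · simp only [hBm, decide_false, Bool.false_eq_true, ↓reduceIte]
      have hAm : MatchA D σ j false := by
        rcases hxor with ⟨h, -⟩ | ⟨h, -⟩
        · exact h
        · exact absurd h hBm
      exact ⟨Y1, Y2, hY1, hY2, hA.2 hAm⟩
  · rintro ⟨j', m'⟩ hp
    obtain ⟨-, ⟨Y', hY'c, hY'l⟩, Y1', Y2', h1', h2', hl'⟩ := hp
    dsimp only at hY'c h1' h2'
    have hY'r : (sideGraph ξ).Reachable s Y' := (xiLinked_iff_reachable ξ s Y').1 hY'l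
    have hY'Yj := hreach_corner j' Y' hY'c hY'r
    subst hY'Yj
    have hjj : j' = j := cornerFace_idx_unique D hY'c hj
    subst hjj
    have hY1' : Y1' = Y1 := cornerFace_unique D h1' hY1
    subst hY1'
    cases m'
    · simp only [Bool.false_eq_true, ↓reduceIte] at h2'
      have hY2' : Y2' = Y2 := cornerFace_unique D h2' hY2
      subst hY2'
      have hAm : MatchA D σ j' false := hA.1 hl'
      have hBm : ¬ MatchB D σ j' false := by
        rcases hxor with ⟨-, h⟩ | ⟨-, h⟩
        · exact h
        · exact absurd hAm h
      simp only [hBm, decide_false]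
    · simp only [↓reduceIte] at h2'
      have hY2' : Y2' = Y4 := cornerFace_unique D h2' hY4
      subst hY2'
      have hBm : MatchB D σ j' false := hB.1 hl'
      simp only [hBm, decide_true]


end Bdry

end Literature.Probability.Percolation.FivePoint

/-! # Door (v-d): the six-point transport at a BOUNDARY edge — part 3: N1 (uniform), and the corner endpoint (b-engine-2 g7) -/

open Finset

namespace Literature.Probability.Percolation.FivePoint

open Literature.Probability.Percolation Literature.Probability.LatticeModels

namespace Bdry

open N5

variable (D : TriMarkedDomain 5)

/-- Auxiliary. [folklore] -/
private theorem fin3_cases₆ (v j : Fin 3) : j = v ∨ j = v + 1 ∨ j = v + 2 := by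
  revert v j; decide

/-- Auxiliary propositional fact. [folklore] -/
private theorem xor_toggle₁ {c p q : Prop} (h : ¬ (p ∧ q)) : (¬ (Xor c p ↔ (p ∨ q))) ↔ Xor c q := by
  unfold Xor; tauto

/-- Auxiliary propositional fact. [folklore] -/
private theorem xor_toggle₂ {c p q : Prop} (h : ¬ (p ∧ q)) : (¬ (Xor c q ↔ (p ∨ q))) ↔ Xor c p := by
  unfold Xor; tauto

variable {D}

/-- the corner clause as membership in `corners D` (= the tree's `N5.h1_mem_corners_iff`, restated privately). [folklore] -/
private theorem exists_corner_iff_mem (F : HexVertex) : (∃ j : Fin 5, IsCornerFace D j F) ↔ F ∈ corners D := by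
  rw [mem_corners]
  exact exists_congr fun j => isCornerFace_iff_eq_yc D

/-! ### N1 at a boundary-or-inner edge: `#T6∂(x) + #T6∂(x') = 2 ^ #G`, uniformly (no hypothesis on the faces) -/

variable (D) in
/-- **N1∂**: the two boundary six-point spaces of an edge of `H_G` whose bond has an endpoint in `G` have `2 ^ #G` elements together —
split `{ξ ⊆ hBonds : odd(ξ) = corners Δ {x}}` by `b₀ ∈ ξ`; erasing `b₀` toggles the parities of `x` and `x'`. [cite: KhristoforovSmirnov2021, §1.2 (loop configurations, pp. 2–4)] -/
theorem sixCount_b {x x' : HexVertex} {u v : Site 2} (hadj : hexGraph.Adj x x') (he : faceEdge x x' = {u, v}) (hu : u ∈ D.verts) :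
    #(loopSpace6b D u v x) + #(loopSpace6b D u v x') = 2 ^ #D.verts := by
  classical
  obtain ⟨huv, hux, hvx, hux', hvx', hxT, hx'T, hxx', huvadj, hbB⟩ := edge_facts D hadj he hu
  -- the odd set O = corners Δ {x}
  set O : Finset HexVertex := if x ∈ corners D then (corners D).erase x else insert x (corners D) with hO
  have hmemO : ∀ F, F ∈ O ↔ Xor (∃ j : Fin 5, IsCornerFace D j F) (F = x) := by
    intro F
    rw [exists_corner_iff_mem, hO]
    unfold Xor
    split_ifs with hxc
    · rw [Finset.mem_erase]
      constructor
      · rintro ⟨hne, hF⟩; exact Or.inl ⟨hF, hne⟩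
      · rintro (⟨hF, hne⟩ | ⟨rfl, hn⟩)
        · exact ⟨hne, hF⟩
        · exact absurd hxc hn
    · rw [Finset.mem_insert]
      constructor
      · rintro (rfl | hF)
        · exact Or.inr ⟨rfl, hxc⟩
        · exact Or.inl ⟨hF, fun e => hxc (e ▸ hF)⟩
      · rintro (⟨hF, -⟩ | ⟨rfl, -⟩)
        · exact Or.inr hF
        · exact Or.inl rfl
  have hOsub : O ⊆ triFacesTouching D.verts := by
    intro F hF
    rw [hO] at hF
    split_ifs at hF with hxc
    · obtain ⟨i, rfl⟩ := (mem_corners D).1 (Finset.mem_of_mem_erase hF); exact yc_mem_touching D i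
    · rcases Finset.mem_insert.1 hF with rfl | hF
      · exact hxT
      · obtain ⟨i, rfl⟩ := (mem_corners D).1 hF; exact yc_mem_touching D i
  have hcard5 : #(corners D) = 5 := by
    unfold corners
    rw [Finset.card_image_of_injective _ (yc_injective D), Finset.card_univ, Fintype.card_fin]
  have hOeven : Even #O := by
    rw [hO]
    split_ifs with hxc
    · rw [Finset.card_erase_of_mem hxc, hcard5]; decide
    · rw [Finset.card_insert_of_notMem hxc, hcard5]; decide
  have hcount := card_filter_parity_eq D hOsub hOeven
  set S := (hBonds D).powerset.filter fun ξ => ∀ F ∈ triFacesTouching D.verts, (Odd (xiDeg ξ F) ↔ F ∈ O) with hS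
  have htoggle : ∀ (B : Finset (Sym2 (Site 2))) (F : HexVertex), F ∈ triFacesTouching D.verts →
      (Odd (xiDeg (symmDiff B {s(u, v)}) F) ↔ ¬ (Odd (xiDeg B F) ↔ (F = x ∨ F = x'))) := by
    intro B F hF
    rw [xorDeg_holds B {s(u, v)} F, odd_xiDeg_singleton_iff' D hadj he hu hF]
  have hnotboth : ∀ F : HexVertex, ¬ (F = x ∧ F = x') := by
    rintro F ⟨rfl, h⟩; exact hxx' h
  have hS0 : S.filter (fun ξ => s(u, v) ∉ ξ) = loopSpace6b D u v x := by
    ext ξ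
    rw [Finset.mem_filter, hS, Finset.mem_filter, Finset.mem_powerset, mem_loopSpace6b]
    constructor
    · rintro ⟨⟨hsub, hpar⟩, hb⟩
      refine ⟨fun e he' => Finset.mem_erase.2 ⟨fun h => hb (by rw [← h]; exact he'), hsub he'⟩, fun F hF => ?_⟩
      rw [hpar F hF, hmemO]
    · rintro ⟨hsub, hpar⟩
      refine ⟨⟨fun e he' => (Finset.mem_erase.1 (hsub he')).2, fun F hF => ?_⟩, fun hb => (Finset.mem_erase.1 (hsub hb)).1 rfl⟩
      rw [hpar F hF, hmemO]
  have hS1 : #(S.filter (fun ξ => s(u, v) ∈ ξ)) = #(loopSpace6b D u v x') := by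
    refine Finset.card_bij (fun ξ _ => ξ.erase s(u, v)) (fun ξ hξ => ?_) (fun ξ hξ ξ' hξ' h => ?_) (fun ζ hζ => ?_)
    · obtain ⟨hξS, hb⟩ := Finset.mem_filter.1 hξ
      rw [hS, Finset.mem_filter, Finset.mem_powerset] at hξS
      obtain ⟨hsub, hpar⟩ := hξS
      rw [mem_loopSpace6b]
      refine ⟨Finset.erase_subset_erase _ hsub, fun F hF => ?_⟩
      rw [erase_eq_symmDiff hb, htoggle ξ F hF, hpar F hF, hmemO]
      exact xor_toggle₁ (hnotboth F)
    · have hb1 : s(u, v) ∈ ξ := (Finset.mem_filter.1 hξ).2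
      have hb2 : s(u, v) ∈ ξ' := (Finset.mem_filter.1 hξ').2
      rw [← Finset.insert_erase hb1, ← Finset.insert_erase hb2, h]
    · obtain ⟨hsub, hpar⟩ := mem_loopSpace6b.1 hζ
      have hb_not : s(u, v) ∉ ζ := fun h => (Finset.mem_erase.1 (hsub h)).1 rfl
      refine ⟨insert s(u, v) ζ, Finset.mem_filter.2 ⟨?_, Finset.mem_insert_self _ _⟩, Finset.erase_insert hb_not⟩
      rw [hS, Finset.mem_filter, Finset.mem_powerset]
      refine ⟨Finset.insert_subset hbB fun e he' => (Finset.mem_erase.1 (hsub he')).2, fun F hF => ?_⟩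
      rw [insert_eq_symmDiff hb_not, htoggle ζ F hF, hpar F hF, hmemO]
      exact xor_toggle₂ (hnotboth F)
  rw [← hS0, ← hS1, add_comm, Finset.card_filter_add_card_filter_not]
  exact hcount

/-! ### The corner endpoint: an edge `{Y, x'}` of `H_G` with `Y = y_k` a corner face -/

section cornerEnd

variable {Y x' : HexVertex} {u v : Site 2} {k : Fin 5} (hadj : hexGraph.Adj Y x') (he : faceEdge Y x' = {u, v})
  (hu : u ∈ D.verts) (hY : IsCornerFace D k Y)
include hadj he hu hY

/-- at a corner face only the marked site is in `G`: the endpoint `u ∈ G` of the bond is `v_k`. [cite: BollobasRiordan2006, Ch. 7 §7.2.2 pp. 168–171] -/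
theorem cornerEnd_fst_eq : u = D.markSite k := by
  obtain ⟨-, huY, -, -, -, -, -, -, -, -⟩ := edge_facts D hadj he hu
  obtain ⟨w, hw, hw1, hw2, -⟩ := isCornerFace_typeII D hY
  obtain ⟨i, hi⟩ := mem_hexFaceVertices_iff_faceVertex.1 huY
  rcases fin3_cases₆ w i with e | e | e
  · rw [hi, e, hw]
  · rw [hi, e] at hu; exact absurd hu hw1
  · rw [hi, e] at hu; exact absurd hu hw2

/-- … the other endpoint is outside `G`. [cite: BollobasRiordan2006, Ch. 7 §7.2.2 pp. 168–171] -/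
theorem cornerEnd_snd_not_mem : v ∉ D.verts := by
  intro hv
  obtain ⟨huv, huY, hvY, -, -, -, -, -, -, -⟩ := edge_facts D hadj he hu
  exact not_corner_of_two_mem D huY hvY hu hv huv k hY

/-- … the bond is the bond of the marked dart or of its predecessor. [cite: BollobasRiordan2006, Ch. 7 §7.2.2 pp. 168–171] -/
theorem cornerEnd_snd_eq_or : v = (D.markDart k).2 ∨ v = (predDart D k).2 := by
  obtain ⟨huv, -, hvY, -, -, -, -, -, -, -⟩ := edge_facts D hadj he hu
  have hv' : v ∈ ({D.markSite k, (D.markDart k).2, (predDart D k).2} : Finset (Site 2)) := by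
    have : hexFaceVertices Y = {D.markSite k, (D.markDart k).2, (predDart D k).2} := hY
    rw [← this]; exact hvY
  simp only [Finset.mem_insert, Finset.mem_singleton] at hv'
  rcases hv' with h | h | h
  · exact absurd (h.trans (cornerEnd_fst_eq hadj he hu hY).symm) huv.symm
  · exact Or.inl h
  · exact Or.inr h

/-- … so the other face `x'` is not a corner face. [cite: BollobasRiordan2006, Ch. 7 §7.2.2 pp. 168–171] -/
theorem cornerEnd_other_not_corner : x' ∉ corners D := by
  intro hx'
  obtain ⟨k', rfl⟩ := (mem_corners D).1 hx'
  have h1 : u = D.markSite k := cornerEnd_fst_eq hadj he hu hY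
  have h2 : u = D.markSite k' :=
    cornerEnd_fst_eq (u := u) (v := v) hadj.symm (by rw [faceEdge_comm]; exact he) hu (yc_spec D k')
  have hkk : k = k' := D.mark_injective (h1.symm.trans h2)
  subst hkk
  exact hadj.ne (eq_yc D hY)

/-- the side count of the corner endpoint in an edge set avoiding `b₀` is at most one (its outer side is not an `H_G`-bond and `b₀` is
excluded). [cite: KhristoforovSmirnov2021, §1.2 (loop configurations, pp. 2–4)] -/
theorem cornerEnd_xiDeg_le_one {B : Finset (Sym2 (Site 2))} (hB : B ⊆ (hBonds D).erase s(u, v)) : xiDeg B Y ≤ 1 := by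
  classical
  obtain ⟨huv, huY, hvY, -, -, -, -, -, -, hbB⟩ := edge_facts D hadj he hu
  obtain ⟨j₂, hj₂⟩ := exists_side_not_mem_hBonds_of_corner D hY
  obtain ⟨j₀, hj₀⟩ := exists_side_eq_of_inc D hbB (inc_mk_iff.2 ⟨huY, hvY⟩)
  have hne : j₀ ≠ j₂ := fun e => hj₂ (by rw [← e, ← hj₀]; exact hbB)
  unfold xiDeg
  have hsub : ((Finset.univ : Finset (Fin 3)).filter fun j => s(faceVertex Y (j + 1), faceVertex Y (j + 2)) ∈ B) ⊆
      (Finset.univ.erase j₀).erase j₂ := by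
    intro j hj
    have hjB : side Y j ∈ B := (Finset.mem_filter.1 hj).2
    rw [Finset.mem_erase, Finset.mem_erase]
    refine ⟨fun e => hj₂ (e ▸ Finset.mem_of_mem_erase (hB hjB)), fun e => ?_, Finset.mem_univ _⟩
    have := (Finset.mem_erase.1 (hB hjB)).1
    exact this (by rw [e, ← hj₀])
  refine (Finset.card_le_card hsub).trans ?_
  rw [Finset.card_erase_of_mem (Finset.mem_erase.2 ⟨hne.symm, Finset.mem_univ _⟩),
    Finset.card_erase_of_mem (Finset.mem_univ _), Finset.card_univ, Fintype.card_fin]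

/-- … hence, if even, it is zero and `Y` is ISOLATED in the side graph. [cite: KhristoforovSmirnov2021, §1.2 (loop configurations, pp. 2–4)] -/
theorem cornerEnd_isolated {B : Finset (Sym2 (Site 2))} (hB : B ⊆ (hBonds D).erase s(u, v)) (heven : ¬ Odd (xiDeg B Y)) :
    ∀ F, (sideGraph B).Reachable Y F → F = Y := by
  classical
  have h0 : xiDeg B Y = 0 := by
    have h1 := cornerEnd_xiDeg_le_one hadj he hu hY hB
    rcases Nat.even_or_odd (xiDeg B Y) with ⟨m, hm⟩ | ho
    · omega
    · exact absurd ho heven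
  intro F hF
  obtain ⟨p⟩ := hF
  cases p with
  | nil => rfl
  | cons hYF _ =>
    obtain ⟨j, -, hj⟩ := hYF
    exfalso
    have : 0 < xiDeg B Y := by
      unfold xiDeg
      exact Finset.card_pos.2 ⟨j, Finset.mem_filter.2 ⟨Finset.mem_univ _, hj⟩⟩
    omega

omit hu in
/-- **the boundary space at a corner endpoint `y_k`** is `{ξ ∈ loopSpace D k : b₀ ∉ ξ}` — as a membership statement: parity
`{y_i : i ≠ k}`. [cite: KhristoforovSmirnov2021, §1.2 (loop configurations, pp. 2–4)] -/
theorem mem_loopSpace6b_corner_iff (ξ : Finset (Sym2 (Site 2))) :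
    ξ ∈ loopSpace6b D u v Y ↔ ξ ⊆ (hBonds D).erase s(u, v) ∧ ParityIs D ξ (cornersNe D k) := by
  rw [mem_loopSpace6b]
  refine and_congr_right fun _ => forall₂_congr fun F _ => iff_congr Iff.rfl ?_
  rw [mem_cornersNe]
  have hYk : Y = yc D k := eq_yc D hY
  unfold Xor
  constructor
  · rintro (⟨⟨j, hj⟩, hne⟩ | ⟨rfl, hn⟩)
    · refine ⟨j, fun e => hne ?_, eq_yc D hj⟩
      subst e; rw [hYk]; exact eq_yc D hj
    · exact absurd ⟨k, hY⟩ hn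
  · rintro ⟨j, hjk, rfl⟩
    exact Or.inl ⟨⟨j, yc_spec D j⟩, fun e => hjk (yc_injective D (e.trans hYk))⟩

/-- in the boundary space at the corner endpoint, `Y` is isolated. [cite: KhristoforovSmirnov2021, §1.2 (loop configurations, pp. 2–4)] -/
theorem cornerEnd_isolated_of_mem {ξ : Finset (Sym2 (Site 2))} (hξ : ξ ∈ loopSpace6b D u v Y) :
    ∀ F, (sideGraph ξ).Reachable Y F → F = Y := by
  obtain ⟨hsub, hpar⟩ := (mem_loopSpace6b_corner_iff hadj he hY ξ).1 hξ
  refine cornerEnd_isolated hadj he hu hY hsub fun ho => ?_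
  have := (hpar Y (cornerFace_mem_touching D hY)).1 ho
  rw [eq_yc D hY] at this
  exact yc_not_mem_cornersNe D k this

/-- **N2∂ at the corner endpoint**: every element of the boundary space at `y_k` lies in exactly one class, namely `(k, M)` with `M`
its link pattern (loop lemma through `loopSurj_holds`). [cite: KhristoforovSmirnov2021, §1.2 Lemma 2 (pp. 2–3)] -/
theorem sixStructure_corner {ξ : Finset (Sym2 (Site 2))} (hξ : ξ ∈ loopSpace6b D u v Y) :
    ∃! p : Fin 5 × Bool, InClassb D u v Y p.1 p.2 ξ := by
  classical
  obtain ⟨hsub, hpar⟩ := (mem_loopSpace6b_corner_iff hadj he hY ξ).1 hξ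
  have hiso := cornerEnd_isolated_of_mem hadj he hu hY hξ
  have hξB : ξ ⊆ hBonds D := fun e he' => Finset.mem_of_mem_erase (hsub he')
  have hmem : ξ ∈ loopSpace D k := by
    unfold loopSpace
    refine Finset.mem_filter.2 ⟨Finset.mem_powerset.2 hξB, fun F hF => ?_⟩
    rw [hpar F hF, mem_cornersNe]
    constructor
    · rintro ⟨j, hjk, rfl⟩; exact ⟨j, hjk, yc_spec D j⟩
    · rintro ⟨j, hjk, hj⟩; exact ⟨j, hjk, eq_yc D hj⟩
  obtain ⟨σ, hσ⟩ := loopSurj_holds D k false ξ hmem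
  have hA : XiLinked ξ (yc D (k + 1)) (yc D (k + 2)) ↔ MatchA D σ k false := by
    rw [← hσ, xiLinked_xiOf_iff]
    unfold MatchA
    constructor
    · intro h; exact ⟨_, _, yc_spec D _, yc_spec D _, h⟩
    · rintro ⟨Y1', Y2', h1, h2, h⟩
      rw [← eq_yc D h1, ← eq_yc D h2]; exact h
  have hB : XiLinked ξ (yc D (k + 1)) (yc D (k + 4)) ↔ MatchB D σ k false := by
    rw [← hσ, xiLinked_xiOf_iff]
    unfold MatchB
    constructor
    · intro h; exact ⟨_, _, yc_spec D _, yc_spec D _, h⟩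
    · rintro ⟨Y1', Y4', h1, h4, h⟩
      rw [← eq_yc D h1, ← eq_yc D h4]; exact h
  have hxor : Xor (MatchA D σ k false) (MatchB D σ k false) := (fiveMarkedLoopLemma_holds D σ k).1
  refine ⟨(k, decide (MatchB D σ k false)), ?_, ?_⟩
  · show InClassb D u v Y k (decide (MatchB D σ k false)) ξ
    refine ⟨hξ, ⟨Y, hY, Relation.ReflTransGen.refl⟩, ?_⟩
    by_cases hBm : MatchB D σ k false
    · simp only [hBm, decide_true, ↓reduceIte]
      exact ⟨_, _, yc_spec D _, yc_spec D _, hB.2 hBm⟩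
    · simp only [hBm, decide_false, Bool.false_eq_true, ↓reduceIte]
      have hAm : MatchA D σ k false := by
        rcases hxor with ⟨h, -⟩ | ⟨h, -⟩
        · exact h
        · exact absurd h hBm
      exact ⟨_, _, yc_spec D _, yc_spec D _, hA.2 hAm⟩
  · rintro ⟨j', m'⟩ hp
    obtain ⟨-, ⟨Y', hY'c, hY'l⟩, Y1', Y2', h1', h2', hl'⟩ := hp
    dsimp only at hY'c h1' h2'
    have hY'Y : Y' = Y := hiso Y' ((xiLinked_iff_reachable ξ Y Y').1 hY'l)
    subst hY'Y
    have hjj : j' = k := cornerFace_idx_unique D hY'c hY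
    subst hjj
    rw [eq_yc D h1'] at hl'
    cases m'
    · simp only [Bool.false_eq_true, ↓reduceIte] at h2'
      rw [eq_yc D h2'] at hl'
      have hAm : MatchA D σ j' false := hA.1 hl'
      have hBm : ¬ MatchB D σ j' false := by
        rcases hxor with ⟨-, h⟩ | ⟨-, h⟩
        · exact h
        · exact absurd hAm h
      simp only [hBm, decide_false]
    · simp only [↓reduceIte] at h2'
      rw [eq_yc D h2'] at hl'
      have hBm : MatchB D σ j' false := hB.1 hl'
      simp only [hBm, decide_true]

open Classical in
/-- at the corner endpoint `y_k` the classes `(j, M)` with `j ≠ k` are empty. [cite: KhristoforovSmirnov2021, §1.2 (loop configurations, pp. 2–4)] -/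
theorem filter_inClassb_corner_eq_empty {j : Fin 5} (hjk : j ≠ k) (m : Bool) :
    (loopSpace6b D u v Y).filter (fun ξ => InClassb D u v Y j m ξ) = ∅ := by
  rw [Finset.filter_eq_empty_iff]
  rintro ξ hξ ⟨-, ⟨Y', hY'c, hY'l⟩, -⟩
  have hY'Y : Y' = Y := cornerEnd_isolated_of_mem hadj he hu hY hξ Y' ((xiLinked_iff_reachable ξ Y Y').1 hY'l)
  subst hY'Y
  exact hjk (cornerFace_idx_unique D hY'c hY)

end cornerEnd

end Bdry

end Literature.Probability.Percolation.FivePoint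

/-! # Door (v-d): the six-point transport at a BOUNDARY edge — part 4: the transport at a corner endpoint (b-engine-2 g7)

Edge `{Y, x'}` of `H_G` with `Y = y_k` a corner face (bond `b₀ = s(u, v)`, `u = v_k ∈ G`). Two cases of the K5′ transport:
(c) class index `j = k`: direct bijection `B ↦ B ∖ {b₀}` (no transport path); (b) `j ≠ k`: the one-sided involution. -/

open Finset

namespace Literature.Probability.Percolation.FivePoint

open Literature.Probability.Percolation Literature.Probability.LatticeModels

namespace Bdry

open N5

variable {D : TriMarkedDomain 5}

/-- `loopSpace D j` as a parity profile. [cite: KhristoforovSmirnov2021, §1.2 (loop configurations, pp. 2–4)] -/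
theorem mem_loopSpace_iff_parityIs (j : Fin 5) (B : Finset (Sym2 (Site 2))) :
    B ∈ loopSpace D j ↔ B ⊆ hBonds D ∧ ParityIs D B (cornersNe D j) := by
  classical
  unfold loopSpace ParityIs
  rw [Finset.mem_filter, Finset.mem_powerset]
  refine and_congr_right fun _ => forall₂_congr fun F _ => ?_
  rw [mem_cornersNe]
  exact iff_congr Iff.rfl (exists_congr fun i => and_congr_right fun _ => isCornerFace_iff_eq_yc D)

/-- the side graph is monotone in the edge set (= the tree's `N5.ht2_sideGraph_mono`, restated privately). [folklore] -/
private theorem sideGraph_mono {A B : Finset (Sym2 (Site 2))} (h : A ⊆ B) : sideGraph A ≤ sideGraph B := by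
  rintro F F' ⟨j, hF', hj⟩
  exact ⟨j, hF', h hj⟩

/-- `E`-chains through `P`-faces are monotone in `E`. [cite: KhristoforovSmirnov2021, §1.2 Lemma 2 (pp. 2–3)] -/
theorem chain_mono {E E' : Finset (Sym2 (Site 2))} (h : E ⊆ E') (P : HexVertex → Prop) {a b : HexVertex}
    (hc : Relation.ReflTransGen (fun F F' => (sideGraph E).Adj F F' ∧ P F ∧ P F') a b) :
    Relation.ReflTransGen (fun F F' => (sideGraph E').Adj F F' ∧ P F ∧ P F') a b := by
  induction hc with
  | refl => exact Relation.ReflTransGen.refl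
  | tail _ hbc ih =>
    obtain ⟨hadj', hP1, hP2⟩ := hbc
    exact ih.tail ⟨sideGraph_mono h hadj', hP1, hP2⟩

/-- the pattern clause of `InClass`/`InClassb` is `patm`. [cite: KhristoforovSmirnov2021, §1.2 (loop configurations, pp. 2–4)] -/
theorem pattern_clause_iff_patm (j : Fin 5) (m : Bool) (A : Finset (Sym2 (Site 2))) :
    (∃ Y₁ Y₂ : HexVertex, IsCornerFace D (j + 1) Y₁ ∧ IsCornerFace D (if m then j + 4 else j + 2) Y₂ ∧ XiLinked A Y₁ Y₂) ↔
      patm D j m A := by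
  unfold patm
  constructor
  · rintro ⟨Y₁, Y₂, h1, h2, hl⟩; rwa [← eq_yc D h1, ← eq_yc D h2]
  · intro hl; exact ⟨_, _, yc_spec D _, yc_spec D _, hl⟩

/-- a good transport set cannot end at a face of the avoided vertex set. [cite: KhristoforovSmirnov2021, §1.2 (loop configurations, pp. 2–4)] -/
theorem goodSet_end_ne {x x' : HexVertex} {u v : Site 2} {j : Fin 5} {V : Finset HexVertex} {γ : Finset (Sym2 (Site 2))}
    {t : HexVertex} (hG : GoodSet D x x' u v j V γ t) {F : HexVertex} (hFV : F ∈ V) (hFT : F ∈ triFacesTouching D.verts) : t ≠ F := by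
  classical
  rintro rfl
  obtain ⟨-, -, havoid, hpar⟩ := hG
  have ho : Odd (xiDeg γ t) := (hpar t hFT).2 (Or.inr rfl)
  have hpos : 0 < xiDeg γ t := Nat.pos_of_ne_zero fun h0 => by rw [h0] at ho; exact absurd ho (by decide)
  unfold xiDeg at hpos
  obtain ⟨i, hi⟩ := Finset.card_pos.1 hpos
  exact havoid _ (Finset.mem_filter.1 hi).2 t hFV (inc_side t i)

section cornerEnd

variable {Y x' : HexVertex} {u v : Site 2} {k : Fin 5} (hadj : hexGraph.Adj Y x') (he : faceEdge Y x' = {u, v})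
  (hu : u ∈ D.verts) (hY : IsCornerFace D k Y)
include hadj he hu hY

omit hadj he hu in
/-- Auxiliary propositional fact. [folklore] -/
private theorem joinedOff_or_corner_iff (m : Bool) (B : Finset (Sym2 (Site 2))) :
    (patm D k m B ∧ (JoinedOff D (hBonds D) k B Y ∨ JoinedOff D (hBonds D) k B x')) ↔ (patm D k m B ∧ ¬ ipv D k B Y) := by
  have hYk : Y = yc D k := eq_yc D hY
  refine and_congr_right fun _ => ?_
  constructor
  · rintro (⟨-, h, -⟩ | ⟨-, h, -⟩) <;> rwa [hYk]
  · intro h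
    exact Or.inl ⟨h, hYk ▸ h, by rw [hYk]⟩

open Classical in
/-- **CASE (c): the transport at a corner endpoint for its OWN class index** —
`#W∂_{k,M}(y_k) + #W_{k,M}(x') = #{T ⊆ G : Match_M(k) ∧ (y_k or x' joined to y_k)}`: the colourings with `b₀ ∉ ξ_k(T)` are exactly
`W∂_{k,M}(y_k)` (then `y_k` is isolated from the interfaces), those with `b₀ ∈ ξ_k(T)` map to `W_{k,M}(x')` by erasing `b₀` (the loop
through `y_k` and `x'` becomes the path from `x'` to `y_k`). [cite: KhristoforovSmirnov2021, §1.2 (loop configurations, pp. 2–4)] -/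
theorem transport_corner_self (c m : Bool) :
    #((loopSpace6b D u v Y).filter fun ξ => InClassb D u v Y k m ξ) +
        #((loopSpace6 D u v x').filter fun ξ => InClass D u v x' k m ξ) =
      #(D.verts.powerset.filter fun T : Finset (Site 2) =>
        (if m then MatchB D (↑T : Set (Site 2)) k c else MatchA D (↑T : Set (Site 2)) k c) ∧
          (Joined D (↑T : Set (Site 2)) k c Y ∨ Joined D (↑T : Set (Site 2)) k c x')) := by
  classical
  obtain ⟨huv, huY, hvY, hux', hvx', hYT, hx'T, hYx', huvadj, hbB⟩ := edge_facts D hadj he hu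
  have hx'C : x' ∉ corners D := cornerEnd_other_not_corner hadj he hu hY
  have hYk : Y = yc D k := eq_yc D hY
  have hE₀B : (hBonds D).erase s(u, v) ⊆ hBonds D := Finset.erase_subset _ _
  rw [transportColour_holds D Y x' c k m]
  -- domR as the filter of `loopSpace k` by `patm ∧ ¬ ipv y_k`
  set R := (loopSpace D k).filter fun B => patm D k m B ∧ ¬ ipv D k B Y with hR
  have hdomR : domR D Y x' k m = R := by
    unfold domR
    exact Finset.filter_congr fun B _ => joinedOff_or_corner_iff hY m B
  rw [hdomR, ← Finset.card_filter_add_card_filter_not (s := R) (fun B => s(u, v) ∉ B)]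
  have htoggle : ∀ (B : Finset (Sym2 (Site 2))) (F : HexVertex), F ∈ triFacesTouching D.verts →
      (Odd (xiDeg (symmDiff B {s(u, v)}) F) ↔ ¬ (Odd (xiDeg B F) ↔ (F = Y ∨ F = x'))) := by
    intro B F hF
    rw [xorDeg_holds B {s(u, v)} F, odd_xiDeg_singleton_iff' D hadj he hu hF]
  congr 1
  · -- b₀ ∉ B: exactly the boundary class at y_k
    congr 1
    ext ξ
    rw [Finset.mem_filter, hR, Finset.mem_filter, Finset.mem_filter, mem_loopSpace_iff_parityIs]
    unfold InClassb
    rw [mem_loopSpace6b_corner_iff hadj he hY, pattern_clause_iff_patm]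
    constructor
    · rintro ⟨⟨hξE, hpar⟩, -, -, hpat⟩
      have hiso := cornerEnd_isolated_of_mem hadj he hu hY ((mem_loopSpace6b_corner_iff hadj he hY ξ).2 ⟨hξE, hpar⟩)
      refine ⟨⟨⟨hξE.trans hE₀B, hpar⟩, hpat, ?_⟩, fun hb => (Finset.mem_erase.1 (hξE hb)).1 rfl⟩
      rintro ⟨i, hik, hr⟩
      have := hiso (yc D i) hr.symm
      rw [hYk] at this
      exact hik (yc_injective D this)
    · rintro ⟨⟨⟨hξB, hpar⟩, hpat, -⟩, hb⟩
      have hξE : ξ ⊆ (hBonds D).erase s(u, v) := fun e he' => Finset.mem_erase.2 ⟨fun h => hb (h ▸ he'), hξB he'⟩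
      exact ⟨⟨hξE, hpar⟩, ⟨hξE, hpar⟩, ⟨Y, hY, Relation.ReflTransGen.refl⟩, hpat⟩
  · -- b₀ ∈ B: erase b₀ onto W_{k,M}(x')
    have hfilt : R.filter (fun B => ¬ s(u, v) ∉ B) = R.filter (fun B => s(u, v) ∈ B) :=
      Finset.filter_congr fun B _ => not_not
    rw [hfilt]
    symm
    refine Finset.card_bij (fun B _ => B.erase s(u, v)) (fun B hB => ?_) (fun B₁ hB₁ B₂ hB₂ hEq => ?_) (fun A hA => ?_)
    · -- maps into
      obtain ⟨hBR, hb⟩ := Finset.mem_filter.1 hB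
      rw [hR, Finset.mem_filter, mem_loopSpace_iff_parityIs] at hBR
      obtain ⟨⟨hBB, hparB⟩, hpat, hnipv⟩ := hBR
      have hnipv' : ¬ ipv D k B x' := by
        rintro ⟨i, hik, hr⟩
        exact hnipv ⟨i, hik, hr.trans (sideGraph_adj_of_b0_mem D hadj he hu hb).symm.reachable⟩
      have havoid := b0_avoids D hadj he hu hnipv hnipv'
      rw [c_mem_filter_inClass_iff]
      have hAE : B.erase s(u, v) ⊆ (hBonds D).erase s(u, v) := Finset.erase_subset_erase _ hBB
      have hparA : ParityIs D (B.erase s(u, v)) (insert x' (corners D)) := by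
        intro F hF
        rw [erase_eq_symmDiff hb, htoggle B F hF, hparB F hF, hYk]
        exact parity_shift₁ D k hx'C F
      refine ⟨hAE, hparA, ?_, ?_⟩
      · -- x' is linked to y_k: the other odd face of its component
        have hdeg : ∀ F, xiDeg (B.erase s(u, v)) F ≤ 2 := xiDeg_le_two_of_odd_imp D hadj he hu hAE fun F hF ho => by
          have := (hparA F hF).1 ho
          rw [Finset.mem_insert, mem_corners] at this
          rcases this with h | ⟨i, h⟩
          · exact Or.inr (Or.inr h)
          · exact Or.inl ⟨i, h ▸ yc_spec D i⟩
        have hYodd : Odd (xiDeg (B.erase s(u, v)) Y) :=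
          (hparA Y hYT).2 (Finset.mem_insert_of_mem (hYk ▸ yc_mem_corners D k))
        obtain ⟨⟨Z, hZY, hZodd, hZr⟩, -⟩ := odd_component D (hAE.trans hE₀B) hdeg hYT hYodd
        have hZT := touching_of_reachable D (hAE.trans hE₀B) hYT hZr
        have hZ := (hparA Z hZT).1 hZodd
        rw [Finset.mem_insert, mem_corners] at hZ
        rcases hZ with rfl | ⟨i, rfl⟩
        · rw [hYk] at hZr; exact hZr.symm
        · by_cases hik : i = k
          · subst hik; exact absurd hYk.symm hZY
          · exact absurd ⟨i, hik, (hZr.mono (sideGraph_mono (Finset.erase_subset _ _))).symm⟩ hnipv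
      · rw [erase_eq_symmDiff hb]
        exact (patm_symmDiff_iff D reachXor_holds hBB havoid).2 hpat
    · -- injective
      have hb1 : s(u, v) ∈ B₁ := (Finset.mem_filter.1 hB₁).2
      have hb2 : s(u, v) ∈ B₂ := (Finset.mem_filter.1 hB₂).2
      rw [← Finset.insert_erase hb1, ← Finset.insert_erase hb2, hEq]
    · -- surjective
      rw [c_mem_filter_inClass_iff] at hA
      obtain ⟨hAE, hparA, hreach, hpat⟩ := hA
      have hAB : A ⊆ hBonds D := hAE.trans hE₀B
      have hbA : s(u, v) ∉ A := fun h => (Finset.mem_erase.1 (hAE h)).1 rfl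
      have hdeg : ∀ F, xiDeg A F ≤ 2 := xiDeg_le_two_of_odd_imp D hadj he hu hAE fun F hF ho => by
        have := (hparA F hF).1 ho
        rw [Finset.mem_insert, mem_corners] at this
        rcases this with h | ⟨i, h⟩
        · exact Or.inr (Or.inr h)
        · exact Or.inl ⟨i, h ▸ yc_spec D i⟩
      have hYodd : Odd (xiDeg A Y) := (hparA Y hYT).2 (Finset.mem_insert_of_mem (hYk ▸ yc_mem_corners D k))
      obtain ⟨-, huniq⟩ := odd_component D hAB hdeg hYT hYodd
      have hx'odd : Odd (xiDeg A x') := (hparA x' hx'T).2 (Finset.mem_insert_self _ _)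
      have hYx'r : (sideGraph A).Reachable Y x' := by rw [hYk]; exact hreach.symm
      have hnipvA : ¬ ipv D k A Y := by
        rintro ⟨i, hik, hr⟩
        have hiodd : Odd (xiDeg A (yc D i)) := (hparA _ (yc_mem_touching D i)).2 (Finset.mem_insert_of_mem (yc_mem_corners D i))
        have hiY : yc D i ≠ Y := fun e => hik (yc_injective D (e.trans hYk))
        have := huniq (yc D i) x' hr.symm hYx'r hiodd hx'odd hiY hYx'.symm
        exact hx'C (this ▸ yc_mem_corners D i)
      have hnipvA' : ¬ ipv D k A x' := by
        rintro ⟨i, hik, hr⟩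
        exact hnipvA ⟨i, hik, hr.trans hYx'r.symm⟩
      have havoid := b0_avoids D hadj he hu hnipvA hnipvA'
      have hipv : ∀ F, ipv D k (insert s(u, v) A) F ↔ ipv D k A F := by
        rw [insert_eq_symmDiff hbA]
        exact ipv_symmDiff_iff D reachXor_holds hAB havoid
      refine ⟨insert s(u, v) A, Finset.mem_filter.2 ⟨?_, Finset.mem_insert_self _ _⟩, Finset.erase_insert hbA⟩
      rw [hR, Finset.mem_filter, mem_loopSpace_iff_parityIs]
      refine ⟨⟨Finset.insert_subset hbB hAB, fun F hF => ?_⟩, ?_, fun h => hnipvA ((hipv Y).1 h)⟩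
      · rw [insert_eq_symmDiff hbA, htoggle A F hF, hparA F hF, hYk]
        exact xor_swap (parity_shift₁ D k hx'C F)
      · rw [insert_eq_symmDiff hbA]
        exact (patm_symmDiff_iff D reachXor_holds hAB havoid).2 hpat

open Classical in
/-- **CASE (b): the transport at a corner endpoint for ANOTHER class index `j ≠ k`** —
`#W_{j,M}(x') = #{T ⊆ G : Match_M(j) ∧ (y_k or x' joined to y_j)}` (the class `W∂_{j,M}(y_k)` is empty and `y_k` is never joined to
`y_j`): the one-sided involution `A ↦ A ∆ γ(IP_j(A))`. [cite: KhristoforovSmirnov2021, §1.2 (loop configurations, pp. 2–4)] -/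
theorem transport_corner_other {j : Fin 5} (hjk : j ≠ k) (c m : Bool) :
    #((loopSpace6b D u v Y).filter fun ξ => InClassb D u v Y j m ξ) +
        #((loopSpace6 D u v x').filter fun ξ => InClass D u v x' j m ξ) =
      #(D.verts.powerset.filter fun T : Finset (Site 2) =>
        (if m then MatchB D (↑T : Set (Site 2)) j c else MatchA D (↑T : Set (Site 2)) j c) ∧
          (Joined D (↑T : Set (Site 2)) j c Y ∨ Joined D (↑T : Set (Site 2)) j c x')) := by
  classical
  obtain ⟨huv, huY, hvY, hux', hvx', hYT, hx'T, hYx', huvadj, hbB⟩ := edge_facts D hadj he hu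
  have hx'C : x' ∉ corners D := cornerEnd_other_not_corner hadj he hu hY
  have hYk : Y = yc D k := eq_yc D hY
  have hE₀B : (hBonds D).erase s(u, v) ⊆ hBonds D := Finset.erase_subset _ _
  rw [filter_inClassb_corner_eq_empty hadj he hu hY hjk, Finset.card_empty, zero_add, transportColour_holds D Y x' c j m]
  -- y_k is on the interfaces of every edge set, for the reference corner j ≠ k
  have hYipv : ∀ B : Finset (Sym2 (Site 2)), ipv D j B Y := fun B => ⟨k, fun e => hjk e.symm, by rw [hYk]⟩
  have hYV : ∀ B : Finset (Sym2 (Site 2)), Y ∈ ipvSet D j B := fun B => by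
    unfold ipvSet; exact Finset.mem_filter.2 ⟨hYT, hYipv B⟩
  -- domR = domD' (one-sided, no erasure needed)
  set domD' := ((hBonds D).erase s(u, v)).powerset.filter fun A =>
    ParityIs D A (cornersNe D j) ∧ patm D j m A ∧ JoinedOff D ((hBonds D).erase s(u, v)) j A x' with hdomD'
  have hmemD' : ∀ A, A ∈ domD' ↔ A ⊆ (hBonds D).erase s(u, v) ∧ ParityIs D A (cornersNe D j) ∧ patm D j m A ∧
      JoinedOff D ((hBonds D).erase s(u, v)) j A x' := by
    intro A; rw [hdomD', Finset.mem_filter, Finset.mem_powerset]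
  have hRD : domR D Y x' j m = domD' := by
    ext B
    unfold domR
    rw [Finset.mem_filter, mem_loopSpace_iff_parityIs, hmemD']
    constructor
    · rintro ⟨⟨hBB, hpar⟩, hpat, hJ⟩
      have hJ' : JoinedOff D (hBonds D) j B x' := by
        rcases hJ with hJ | hJ
        · exact absurd (hYipv B) hJ.1
        · exact hJ
      obtain ⟨hnx', hnj, hchain⟩ := hJ'
      have hb : s(u, v) ∉ B := fun hb =>
        hnx' (by obtain ⟨i, hi, hr⟩ := hYipv B; exact ⟨i, hi, hr.trans (sideGraph_adj_of_b0_mem D hadj he hu hb).reachable⟩)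
      refine ⟨fun e he' => Finset.mem_erase.2 ⟨fun h => hb (h ▸ he'), hBB he'⟩, hpar, hpat, hnx', hnj, ?_⟩
      rcases chain_split_b D hadj he hu (fun F => ¬ ipv D j B F) hchain with h | ⟨hPY, -, -⟩
      · exact h
      · exact absurd (hYipv B) hPY
    · rintro ⟨hAE, hpar, hpat, hnx', hnj, hchain⟩
      exact ⟨⟨hAE.trans hE₀B, hpar⟩, hpat, Or.inr ⟨hnx', hnj, chain_mono hE₀B _ hchain⟩⟩
  rw [hRD]
  -- the involution Φ : domD' ≃ W_{j,M}(x')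
  have hDW : ∀ A ∈ domD',
      Phi D Y x' u v j A ∈ (loopSpace6 D u v x').filter (fun ξ => InClass D u v x' j m ξ) ∧
        ipvSet D j (Phi D Y x' u v j A) = ipvSet D j A := by
    intro A hA
    obtain ⟨hAE, hparA, hpat, hJ⟩ := (hmemD' A).1 hA
    have hAB : A ⊆ hBonds D := hAE.trans hE₀B
    have hex : ∃ γ t, GoodSet D Y x' u v j (ipvSet D j A) γ t := goodSet_of_joined_b D (chainEdgeSet_holds D) (Or.inr rfl) hx'C hJ
    obtain ⟨t, htx, hγE, havoid, hγpar⟩ := gam_good D hex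
    set γ := gam D Y x' u v j (ipvSet D j A) with hγ
    have ht : t = x' :=
      htx.elim (fun h => absurd h (goodSet_end_ne (⟨htx, hγE, havoid, hγpar⟩ : GoodSet D Y x' u v j (ipvSet D j A) γ t) (hYV A) hYT)) id
    subst ht
    have hipv : ∀ F, ipv D j (symmDiff A γ) F ↔ ipv D j A F := ipv_symmDiff_iff D reachXor_holds hAB havoid
    have hipvSet : ipvSet D j (symmDiff A γ) = ipvSet D j A := ipvSet_symmDiff D reachXor_holds hAB havoid
    have hPhi : Phi D Y t u v j A = symmDiff A γ := rfl
    rw [hPhi]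
    refine ⟨?_, hipvSet⟩
    have hsub' : symmDiff A γ ⊆ (hBonds D).erase s(u, v) := fun e he' => by
      rcases Finset.mem_symmDiff.1 he' with ⟨h, -⟩ | ⟨h, -⟩
      · exact hAE h
      · exact hγE h
    have hpar' : ParityIs D (symmDiff A γ) (insert t (corners D)) := by
      intro F hF
      rw [xorDeg_holds A γ F, hγpar F hF, hparA F hF]
      exact parity_shift₁ D j hx'C F
    rw [c_mem_filter_inClass_iff]
    refine ⟨hsub', hpar', ?_, (patm_symmDiff_iff D reachXor_holds hAB havoid).2 hpat⟩
    have hdeg' : ∀ F, xiDeg (symmDiff A γ) F ≤ 2 := xiDeg_le_two_of_odd_imp D hadj he hu hsub' fun F hF ho => by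
      have := (hpar' F hF).1 ho
      rw [Finset.mem_insert, mem_corners] at this
      rcases this with h | ⟨i, h⟩
      · exact Or.inr (Or.inr h)
      · exact Or.inl ⟨i, h ▸ yc_spec D i⟩
    have hx'odd : Odd (xiDeg (symmDiff A γ) t) := (hpar' t hx'T).2 (Finset.mem_insert_self _ _)
    obtain ⟨⟨Z, hZs, hZodd, hZr⟩, -⟩ := odd_component D (hsub'.trans hE₀B) hdeg' hx'T hx'odd
    have hZT := touching_of_reachable D (hsub'.trans hE₀B) hx'T hZr
    have hZ := (hpar' Z hZT).1 hZodd
    rw [Finset.mem_insert, mem_corners] at hZ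
    rcases hZ with h | ⟨i, hZi⟩
    · exact absurd h hZs
    · by_cases hij : i = j
      · rw [← hij, ← hZi]; exact hZr
      · exact absurd ((hipv t).1 ⟨i, hij, (hZi ▸ hZr).symm⟩) hJ.1
  have hWD : ∀ A ∈ (loopSpace6 D u v x').filter (fun ξ => InClass D u v x' j m ξ),
      Phi D Y x' u v j A ∈ domD' ∧ ipvSet D j (Phi D Y x' u v j A) = ipvSet D j A := by
    intro A hA
    rw [c_mem_filter_inClass_iff] at hA
    obtain ⟨hAE, hparA, hsj, hpat⟩ := hA
    have hAB : A ⊆ hBonds D := hAE.trans hE₀B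
    obtain ⟨hoff, hgood⟩ := comp_goodSet_b D hadj he hu hAE (Or.inr rfl) hx'C hparA hsj
    obtain ⟨t, htx, hγE, havoid, hγpar⟩ := gam_good D ⟨_, _, hgood⟩
    set γ := gam D Y x' u v j (ipvSet D j A) with hγ
    have ht : t = x' :=
      htx.elim (fun h => absurd h (goodSet_end_ne (⟨htx, hγE, havoid, hγpar⟩ : GoodSet D Y x' u v j (ipvSet D j A) γ t) (hYV A) hYT)) id
    subst ht
    have hipv : ∀ F, ipv D j (symmDiff A γ) F ↔ ipv D j A F := ipv_symmDiff_iff D reachXor_holds hAB havoid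
    have hipvSet : ipvSet D j (symmDiff A γ) = ipvSet D j A := ipvSet_symmDiff D reachXor_holds hAB havoid
    have hPhi : Phi D Y t u v j A = symmDiff A γ := rfl
    rw [hPhi]
    refine ⟨?_, hipvSet⟩
    have hsub' : symmDiff A γ ⊆ (hBonds D).erase s(u, v) := fun e he' => by
      rcases Finset.mem_symmDiff.1 he' with ⟨h, -⟩ | ⟨h, -⟩
      · exact hAE h
      · exact hγE h
    refine (hmemD' _).2 ⟨hsub', fun F hF => ?_, (patm_symmDiff_iff D reachXor_holds hAB havoid).2 hpat, ?_⟩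
    · rw [xorDeg_holds A γ F, hγpar F hF, hparA F hF]
      exact xor_swap (parity_shift₁ D j hx'C F)
    · refine ⟨fun h => hoff t SimpleGraph.Reachable.rfl ((hipv t).1 h), fun h => hoff _ hsj ((hipv _).1 h), ?_⟩
      exact chain_of_reachable (E := (hBonds D).erase s(u, v)) hAE (P := fun F => ¬ ipv D j (symmDiff A γ) F)
        (a := yc D j) (b := t) (fun F hF => fun h => hoff F (hsj.trans hF) ((hipv F).1 h)) hsj.symm
  have hinv : ∀ A, ipvSet D j (Phi D Y x' u v j A) = ipvSet D j A → Phi D Y x' u v j (Phi D Y x' u v j A) = A := by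
    intro A h
    show symmDiff (Phi D Y x' u v j A) (gam D Y x' u v j (ipvSet D j (Phi D Y x' u v j A))) = A
    rw [h]
    exact symmDiff_symmDiff_cancel_right _ _
  symm
  exact Finset.card_bij' (fun A _ => Phi D Y x' u v j A) (fun A _ => Phi D Y x' u v j A) (fun A hA => (hDW A hA).1)
    (fun A hA => (hWD A hA).1) (fun A hA => hinv A (hDW A hA).2) (fun A hA => hinv A (hWD A hA).2)

end cornerEnd

end Bdry

end Literature.Probability.Percolation.FivePoint

/-! # Door (v-d): the six-point transport at a BOUNDARY edge — part 5: the faces N1∂/N2∂/N3∂ assembled, and the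
normalisation `Σ_r midEdgeProb D r c x x' = 1` at EVERY edge of `H_G` (b-engine-2 g7) -/

open Finset

namespace Literature.Probability.Percolation.FivePoint

open Literature.Probability.Percolation Literature.Probability.LatticeModels

namespace Bdry

open N5

variable (D : TriMarkedDomain 5)

open Classical in
/-- **N3∂ — THE SIX-POINT TRANSPORT AT ANY EDGE OF `H_G`** whose bond `s(g, o)` has the endpoint `g ∈ G` (inner or boundary edge,
corner endpoints allowed): `#W∂_{r,M}(x) + #W∂_{r,M}(x') = #{T ⊆ G : Match_M(r) ∧ (x or x' joined to y_r)}`. Off the corners this is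
the tree's K5′ chain re-run (`transportErase_b`, `transportCore_b`, `transportSplit_b`); at a corner endpoint it is
`transport_corner_self` / `transport_corner_other`. [cite: KhristoforovSmirnov2021, §1.2 (loop configurations, pp. 2–4)] -/
theorem sixTransport_b {x x' : HexVertex} {g o : Site 2} (hadj : hexGraph.Adj x x') (he : faceEdge x x' = {g, o})
    (hg : g ∈ D.verts) (c : Bool) (r : Fin 5) (m : Bool) :
    #((loopSpace6b D g o x).filter fun ξ => InClassb D g o x r m ξ) +
        #((loopSpace6b D g o x').filter fun ξ => InClassb D g o x' r m ξ) =
      #(D.verts.powerset.filter fun T : Finset (Site 2) =>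
        (if m then MatchB D (↑T : Set (Site 2)) r c else MatchA D (↑T : Set (Site 2)) r c) ∧
          (Joined D (↑T : Set (Site 2)) r c x ∨ Joined D (↑T : Set (Site 2)) r c x')) := by
  classical
  by_cases hxC : x ∈ corners D
  · -- x is a corner face y_k; then x' is not
    obtain ⟨k, hk⟩ := (mem_corners D).1 hxC
    have hY : IsCornerFace D k x := hk ▸ yc_spec D k
    have hx'C : x' ∉ corners D := cornerEnd_other_not_corner hadj he hg hY
    rw [filter_inClassb_eq_of_not_corner g o hx'C]
    by_cases hrk : r = k
    · subst hrk; exact transport_corner_self hadj he hg hY c m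
    · exact transport_corner_other hadj he hg hY hrk c m
  by_cases hx'C : x' ∈ corners D
  · -- x' is a corner face: the symmetric case
    obtain ⟨k, hk⟩ := (mem_corners D).1 hx'C
    have hY : IsCornerFace D k x' := hk ▸ yc_spec D k
    have he' : faceEdge x' x = {g, o} := by rw [faceEdge_comm]; exact he
    have hsymm : (D.verts.powerset.filter fun T : Finset (Site 2) =>
        (if m then MatchB D (↑T : Set (Site 2)) r c else MatchA D (↑T : Set (Site 2)) r c) ∧
          (Joined D (↑T : Set (Site 2)) r c x ∨ Joined D (↑T : Set (Site 2)) r c x')) =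
        (D.verts.powerset.filter fun T : Finset (Site 2) =>
        (if m then MatchB D (↑T : Set (Site 2)) r c else MatchA D (↑T : Set (Site 2)) r c) ∧
          (Joined D (↑T : Set (Site 2)) r c x' ∨ Joined D (↑T : Set (Site 2)) r c x)) :=
      Finset.filter_congr fun T _ => by rw [or_comm]
    rw [hsymm, add_comm, filter_inClassb_eq_of_not_corner g o hxC]
    by_cases hrk : r = k
    · subst hrk; exact transport_corner_self hadj.symm he' hg hY c m
    · exact transport_corner_other hadj.symm he' hg hY hrk c m
  -- neither face is a corner: the tree chain
  rw [filter_inClassb_eq_of_not_corner g o hxC, filter_inClassb_eq_of_not_corner g o hx'C,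
    ← transportSplit_b D hadj he hg hxC r m, ← transportCore_b D xorDeg_holds reachXor_holds (chainEdgeSet_holds D) hadj he hg hxC hx'C r m,
    ← transportErase_b D xorDeg_holds reachXor_holds hadj he hg (fun h => hxC (cornersNe_subset_corners D r h))
      (fun h => hx'C (cornersNe_subset_corners D r h)) m]
  exact (transportColour_holds D x x' c r m).symm

/-- **N2∂ — STRUCTURE AT ANY EDGE OF `H_G`**: every element of the boundary six-point space at an endpoint lies in exactly one class.
[cite: KhristoforovSmirnov2021, §1.2 (loop configurations, pp. 2–4)] -/
theorem sixStructure_gen {x x' : HexVertex} {g o : Site 2} (hadj : hexGraph.Adj x x') (he : faceEdge x x' = {g, o})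
    (hg : g ∈ D.verts) {s : HexVertex} (hs : s ∈ ({x, x'} : Finset HexVertex)) {ξ : Finset (Sym2 (Site 2))}
    (hξ : ξ ∈ loopSpace6b D g o s) : ∃! p : Fin 5 × Bool, InClassb D g o s p.1 p.2 ξ := by
  classical
  by_cases hsC : s ∈ corners D
  · obtain ⟨k, hk⟩ := (mem_corners D).1 hsC
    have hY : IsCornerFace D k s := hk ▸ yc_spec D k
    rcases Finset.mem_insert.1 hs with rfl | hs'
    · exact sixStructure_corner hadj he hg hY hξ
    · obtain rfl := Finset.mem_singleton.1 hs'
      exact sixStructure_corner hadj.symm (by rw [faceEdge_comm]; exact he) hg hY hξ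
  · rw [loopSpace6b_eq_of_not_corner g o hsC] at hξ
    have h := sixStructure_b D hadj he hg hs hsC hξ
    simpa only [inClassb_iff_of_not_corner g o hsC] using h

open Classical in
/-- a set partitioned by `∃!`-classes: its cardinality is the sum of the class cardinalities. [folklore] -/
private theorem card_eq_sum_card_classes_b {α β : Type*} [Fintype β] (S : Finset α) (P : β → α → Prop)
    (h : ∀ a ∈ S, ∃! b : β, P b a) : #S = ∑ b, #(S.filter fun a => P b a) := by
  simp only [Finset.card_filter]
  rw [Finset.sum_comm]
  rw [Finset.card_eq_sum_ones]
  refine Finset.sum_congr rfl fun a ha => ?_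
  obtain ⟨b, hb, huniq⟩ := h a ha
  rw [Finset.sum_ite, Finset.sum_const_zero, add_zero, Finset.sum_const, smul_eq_mul, mul_one]
  have : (Finset.univ.filter fun b' : β => P b' a) = {b} := by
    ext b'
    simp only [Finset.mem_filter, Finset.mem_univ, true_and, Finset.mem_singleton]
    exact ⟨fun h' => huniq b' h', fun h' => h' ▸ hb⟩
  rw [this, Finset.card_singleton]

/-- **THE FIVE-POINT NORMALISATION AT EVERY EDGE OF `H_G`** — `Σ_{r : Fin 5} midEdgeProb D r c x x' = 1` for every five-marked domain,
every colour and every pair of adjacent faces whose common bond has an endpoint in `G` (inner edges: the tree's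
`hexFivePointNormalisation_holds`; BOUNDARY edges, including those at the corner faces: new). [cite: KhristoforovSmirnov2021, §1.2 (loop configurations, pp. 2–4)] -/
theorem sum_midEdgeProb_eq_one {x x' : HexVertex} {g o : Site 2} (hadj : hexGraph.Adj x x') (he : faceEdge x x' = {g, o})
    (hg : g ∈ D.verts) (c : Bool) : ∑ r : Fin 5, midEdgeProb D r c x x' = 1 := by
  classical
  simp only [midEdgeProb_eq_card_div, card_joined_split]
  rw [← Finset.sum_div]
  rw [div_eq_one_iff_eq (by positivity)]
  have hcount : ∀ r : Fin 5,
      (#(D.verts.powerset.filter fun T : Finset (Site 2) =>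
          MatchA D (↑T : Set (Site 2)) r c ∧ (Joined D (↑T : Set (Site 2)) r c x ∨ Joined D (↑T : Set (Site 2)) r c x')) : ℝ) +
        #(D.verts.powerset.filter fun T : Finset (Site 2) =>
          MatchB D (↑T : Set (Site 2)) r c ∧ (Joined D (↑T : Set (Site 2)) r c x ∨ Joined D (↑T : Set (Site 2)) r c x')) =
      ∑ m : Bool, ((#((loopSpace6b D g o x).filter fun ξ => InClassb D g o x r m ξ) : ℝ) +
        #((loopSpace6b D g o x').filter fun ξ => InClassb D g o x' r m ξ)) := by
    intro r
    rw [Fintype.sum_bool]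
    have hA := sixTransport_b D hadj he hg c r false
    have hB := sixTransport_b D hadj he hg c r true
    simp only [Bool.false_eq_true, ↓reduceIte] at hA hB
    rw [← hA, ← hB]
    push_cast
    ring
  push_cast
  simp only [hcount]
  have hpart : ∀ s ∈ ({x, x'} : Finset HexVertex),
      (∑ r : Fin 5, ∑ m : Bool, (#((loopSpace6b D g o s).filter fun ξ => InClassb D g o s r m ξ) : ℝ)) =
        #(loopSpace6b D g o s) := by
    intro s hs
    have := card_eq_sum_card_classes_b (loopSpace6b D g o s) (fun p : Fin 5 × Bool => InClassb D g o s p.1 p.2)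
      (fun ξ hξ => sixStructure_gen D hadj he hg hs hξ)
    rw [this, Fintype.sum_prod_type]
    push_cast
    rfl
  have hx_mem : x ∈ ({x, x'} : Finset HexVertex) := by simp
  have hx'_mem : x' ∈ ({x, x'} : Finset HexVertex) := by simp
  simp only [Finset.sum_add_distrib]
  rw [hpart x hx_mem, hpart x' hx'_mem]
  have := sixCount_b D hadj he hg
  exact_mod_cast this

/-- the same for an edge presented by its adjacency alone (some endpoint of the common bond lies in `G`). [cite: KhristoforovSmirnov2021, §1.2 (loop configurations, pp. 2–4)] -/
theorem sum_midEdgeProb_eq_one' {x x' : HexVertex} (hadj : hexGraph.Adj x x') (hG : ∃ g ∈ faceEdge x x', g ∈ D.verts) (c : Bool) :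
    ∑ r : Fin 5, midEdgeProb D r c x x' = 1 := by
  obtain ⟨u, v, -, he⟩ := exists_faceEdge_eq_pair hadj
  obtain ⟨g, hgE, hg⟩ := hG
  rw [he, Finset.mem_insert, Finset.mem_singleton] at hgE
  rcases hgE with rfl | rfl
  · exact sum_midEdgeProb_eq_one D hadj he hg c
  · exact sum_midEdgeProb_eq_one D hadj (by rw [he, Finset.pair_comm]) hg c

end Bdry

end Literature.Probability.Percolation.FivePoint

/-! # Door (v-d): the six-point transport at a BOUNDARY edge — part 6: CLASS SUPPORT at a boundary edge of the arc `A_i` (F2∂)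

Only the classes `(i,A), (i,B), (i+1,A), (i+1,B), (i+3,A)` occur: (M1) the white path from `s` to the corner `y_r` in a
colouring realising the reduced configuration forces `arcColour r false i = false`, i.e. `r ∈ {i, i+1, i+3}`; (M2) for
`(i+3, B)` the open crossing `A_{r+1} ↔ A_{r+3}` of pattern `B` and the closed white chain `A_{r+2} → v_r` contradict
Bollobás–Riordan duality (`five_markedDomain_duality`). (b-engine-2 g7) -/

open Finset

namespace Literature.Probability.Percolation.FivePoint

open Literature.Probability.Percolation Literature.Probability.LatticeModels TriMarkedDomain

namespace Bdry

open N5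

variable {D : TriMarkedDomain 5}

/-- Auxiliary. [folklore] -/
private theorem fin3_cases₇ (v j : Fin 3) : j = v ∨ j = v + 1 ∨ j = v + 2 := by
  revert v j; decide

/-- Auxiliary: the colour of the arc `A_i` under reference `r`, `c = false`. [folklore] -/
private theorem arcColour_false_eq_false_iff (r i : Fin 5) : arcColour r false i = false ↔ (r = i ∨ r = i + 1 ∨ r = i + 3) := by
  revert r i; decide

/-- Auxiliary: the super-arc colours at the reference corner. [folklore] -/
private theorem arcColour_false_self (r : Fin 5) : arcColour r false r = false ∧ arcColour r false (r - 1) = false := by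
  revert r; decide

/-- two distinct labelled vertices of a face span one of its sides (= the tree's `N5.ht3_pair_eq_side`, restated privately so that this
file needs only the part-I import). [folklore] -/
private theorem pair_eq_side (F : HexVertex) {i w : Fin 3} (h : i ≠ w) : ∃ j : Fin 3, s(faceVertex F i, faceVertex F w) = side F j := by
  unfold side
  rcases fin3_cases₇ i w with e | e | e
  · exact absurd e.symm h
  · refine ⟨i + 2, ?_⟩
    rw [e, fin3_add_two_add_one, fin3_add_two_add_two]
  · refine ⟨i + 1, ?_⟩
    rw [e, fin3_add_one_add_one, fin3_add_one_add_two, Sym2.eq_swap]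

/-- a dart of a stretch is a boundary dart of that stretch index. [cite: BollobasRiordan2006, Ch. 7 §7.2.2 pp. 168–171] -/
theorem stretchIdx_of_mem_stretch {i : Fin 5} {d : Site 2 × Site 2} (hd : d ∈ D.stretch i) :
    d ∈ triBdryDarts D.verts ∧ stretchIdx D d = i := by
  obtain ⟨hdB, hpos⟩ := posIdx_dpos_of_mem_stretch D hd
  exact ⟨hdB, by rw [stretchIdx_eq_posIdx D hdB]; exact hpos⟩

section whitePath

variable {ξ ξ' : Finset (Sym2 (Site 2))} (hξ : ξ ⊆ hBonds D) {s₀ : HexVertex}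
  (hξ' : ∀ e, e ∈ ξ' ↔ e ∈ ξ ∧ ¬ ∃ F, (sideGraph ξ).Reachable s₀ F ∧ ∃ i : Fin 3, e = side F i)
  {r : Fin 5} {σ : SiteConfig (Site 2)} (hσ : xiOf D σ r false = ξ') (hreach : (sideGraph ξ).Reachable s₀ (yc D r))
include hξ hξ' hσ hreach

omit hξ hreach in
/-- no side of a face on the component of `s₀` lies in the reduced configuration. [cite: KhristoforovSmirnov2021, §1.2 (loop configurations, pp. 2–4)] -/
theorem no_side_of_reach {F : HexVertex} (hF : (sideGraph ξ).Reachable s₀ F) (j : Fin 3) : side F j ∉ xiOf D σ r false := by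
  rw [hσ, hξ']
  rintro ⟨-, h⟩
  exact h ⟨F, hF, j, rfl⟩

/-- **THE WHITE PATH**: in a colouring realising the reduced configuration, every `G`-vertex of every face of the component of `s₀`
(which contains the reference corner `y_r`) is CLOSED — the marked site `v_r` sees the two super-arcs of colour `false` across
non-bicoloured sides, and colours propagate along the component across non-bicoloured bonds. [cite: BollobasRiordan2006, Ch. 7 Lemma 5 pp. 169–171] -/
theorem white_of_reach {F : HexVertex} (hF : (sideGraph ξ).Reachable s₀ F) {w : Fin 3} (hw : faceVertex F w ∈ D.verts) :
    faceVertex F w ∉ σ := by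
  classical
  have hFy : (sideGraph ξ).Reachable F (yc D r) := hF.symm.trans hreach
  rw [SimpleGraph.reachable_iff_reflTransGen] at hFy
  -- no side of a face on the component is bicoloured: two G-vertices of such a face have the same colour
  have mono : ∀ {a : HexVertex}, (sideGraph ξ).Reachable s₀ a → ∀ {i i' : Fin 3}, i ≠ i' →
      faceVertex a i ∈ D.verts → faceVertex a i ∉ σ → faceVertex a i' ∈ D.verts → faceVertex a i' ∉ σ := by
    intro a ha i i' hii' hi hiσ hi'
    obtain ⟨j, hj⟩ := pair_eq_side a hii'
    have hnot : s(faceVertex a i, faceVertex a i') ∉ xiOf D σ r false := by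
      rw [hj]; exact no_side_of_reach hξ' hσ ha j
    have hadj : triGraph.Adj (faceVertex a i) (faceVertex a i') :=
      adj_of_mem_hexFaceVertices (faceVertex_mem a i) (faceVertex_mem a i') (fun e => hii' (faceVertex_injective a e))
    rw [mem_xiOf_iff' D σ r false hadj (Or.inl hi), bicol_iff_of_mem_mem D σ r false hi hi'] at hnot
    intro hin
    exact hnot (iff_of_false hiσ (fun h' => h' hin))
  have key : ∀ a : HexVertex, Relation.ReflTransGen (sideGraph ξ).Adj a (yc D r) →
      (sideGraph ξ).Reachable s₀ a → ∀ w : Fin 3, faceVertex a w ∈ D.verts → faceVertex a w ∉ σ := by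
    intro a hab
    induction hab using Relation.ReflTransGen.head_induction_on with
    | refl =>
      intro hra w hw
      obtain ⟨w₀, h0, h1, h2, hor⟩ := isCornerFace_typeII D (yc_spec D r)
      have hww : w = w₀ := by
        rcases fin3_cases₇ w₀ w with e | e | e
        · exact e
        · exact absurd (e ▸ hw) h1
        · exact absurd (e ▸ hw) h2
      subst hww
      have e1 : w + 2 + 1 = w := fin3_add_two_add_one w
      have e2 : w + 2 + 2 = w + 1 := fin3_add_two_add_two w
      have hside : s(faceVertex (yc D r) w, faceVertex (yc D r) (w + 1)) ∉ xiOf D σ r false := by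
        have := no_side_of_reach hξ' hσ hra (w + 2)
        unfold side at this
        rwa [e1, e2] at this
      have hadj : triGraph.Adj (faceVertex (yc D r) w) (faceVertex (yc D r) (w + 1)) := adj_faceVertex_succ _ w
      rw [mem_xiOf_iff' D σ r false hadj (Or.inl hw), bicol_iff_of_mem_not_mem D σ r false hw h1] at hside
      have harc : arcColour r false (stretchIdx D (faceVertex (yc D r) w, faceVertex (yc D r) (w + 1))) = false := by
        obtain ⟨c0, c4⟩ := arcColour_false_self r
        rcases hor with ⟨hp1, -⟩ | ⟨hm1, -⟩
        · have hd : (faceVertex (yc D r) w, faceVertex (yc D r) (w + 1)) = predDart D r :=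
            Prod.ext (by rw [predDart_fst]; exact h0) hp1
          rw [hd, stretchIdx_predDart, c4]
        · have hd : (faceVertex (yc D r) w, faceVertex (yc D r) (w + 1)) = D.markDart r := Prod.ext h0 hm1
          rw [hd, stretchIdx_markDart, c0]
      rw [harc] at hside
      exact fun hin => hside (iff_of_true hin rfl)
    | head hac hcb ih =>
      rename_i a c
      intro hra w hw
      have hrc : (sideGraph ξ).Reachable s₀ c := hra.trans hac.reachable
      obtain ⟨j, hcj, hmem⟩ := hac
      obtain ⟨x, y, hexy, hxG, -⟩ := exists_rep_of_mem_hBonds D (hξ hmem)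
      have hx : x = faceVertex a (j + 1) ∨ x = faceVertex a (j + 2) := by
        unfold side at hexy
        rcases Sym2.eq_iff.1 hexy with ⟨h1, -⟩ | ⟨-, h2⟩
        · exact Or.inl h1.symm
        · exact Or.inr h2.symm
      obtain ⟨i₁, hi₁⟩ : ∃ i₁ : Fin 3, x = faceVertex a i₁ := by
        rcases hx with h | h
        · exact ⟨j + 1, h⟩
        · exact ⟨j + 2, h⟩
      have hxσ : x ∉ σ := by
        rcases hx with h | h
        · have hc' : x = faceVertex c (oppIdx a j + 2) := by rw [hcj, faceVertex_oppFace_succ_succ]; exact h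
          have := ih hrc (oppIdx a j + 2) (hc' ▸ hxG)
          rwa [← hc'] at this
        · have hc' : x = faceVertex c (oppIdx a j + 1) := by rw [hcj, faceVertex_oppFace_succ]; exact h
          have := ih hrc (oppIdx a j + 1) (hc' ▸ hxG)
          rwa [← hc'] at this
      by_cases hwi : w = i₁
      · rw [hwi, ← hi₁]; exact hxσ
      · exact mono hra (Ne.symm hwi) (hi₁ ▸ hxG) (hi₁ ▸ hxσ) hw
  exact key F hFy hF w hw

/-- **THE CLOSED CHAIN**: from any closed `G`-vertex `g` of `s₀`, a path of closed sites of `G` to a `G`-vertex of any face of the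
component of `s₀` (the `G`-vertices of consecutive faces are equal or adjacent). [cite: BollobasRiordan2006, Ch. 7 Lemma 5 pp. 169–171] -/
theorem closed_chain_of_reach {g : Site 2} (hgs : g ∈ hexFaceVertices s₀) (hg : g ∈ D.verts) {F : HexVertex}
    (hF : (sideGraph ξ).Reachable s₀ F) :
    ∃ w : Fin 3, faceVertex F w ∈ D.verts ∧ PathIn triGraph ((D.verts : Set (Site 2)) ∩ σᶜ) g (faceVertex F w) := by
  classical
  rw [SimpleGraph.reachable_iff_reflTransGen] at hF
  induction hF with
  | refl =>
    obtain ⟨w₀, hw₀⟩ := mem_hexFaceVertices_iff_faceVertex.1 hgs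
    have hgσ : g ∉ σ := by
      rw [hw₀]; exact white_of_reach hξ hξ' hσ hreach SimpleGraph.Reachable.rfl (hw₀ ▸ hg)
    exact ⟨w₀, hw₀ ▸ hg, hw₀ ▸ PathIn.refl ⟨hg, hgσ⟩⟩
  | @tail b c hab hbc ih =>
    obtain ⟨w, hwG, hpath⟩ := ih
    have hb : (sideGraph ξ).Reachable s₀ b := (SimpleGraph.reachable_iff_reflTransGen _ _).2 hab
    have hc : (sideGraph ξ).Reachable s₀ c := hb.trans hbc.reachable
    obtain ⟨j, hcj, hmem⟩ := hbc
    -- a G-endpoint of the crossed side, as a vertex of `b` and of `c`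
    obtain ⟨x, y, hexy, hxG, -⟩ := exists_rep_of_mem_hBonds D (hξ hmem)
    have hx : x = faceVertex b (j + 1) ∨ x = faceVertex b (j + 2) := by
      unfold side at hexy
      rcases Sym2.eq_iff.1 hexy with ⟨h1, -⟩ | ⟨-, h2⟩
      · exact Or.inl h1.symm
      · exact Or.inr h2.symm
    obtain ⟨i₁, hi₁⟩ : ∃ i₁ : Fin 3, x = faceVertex b i₁ := by
      rcases hx with h | h
      · exact ⟨j + 1, h⟩
      · exact ⟨j + 2, h⟩
    obtain ⟨i₂, hi₂⟩ : ∃ i₂ : Fin 3, x = faceVertex c i₂ := by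
      rcases hx with h | h
      · exact ⟨oppIdx b j + 2, by rw [hcj, faceVertex_oppFace_succ_succ]; exact h⟩
      · exact ⟨oppIdx b j + 1, by rw [hcj, faceVertex_oppFace_succ]; exact h⟩
    have hxσ : x ∉ σ := by rw [hi₂]; exact white_of_reach hξ hξ' hσ hreach hc (hi₂ ▸ hxG)
    -- extend the chain inside the face `b` from `faceVertex b w` to `x`
    have hstep : PathIn triGraph ((D.verts : Set (Site 2)) ∩ σᶜ) (faceVertex b w) x := by
      refine PathIn.of_eq_or_adj hpath.right_mem ⟨hxG, hxσ⟩ ?_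
      by_cases hwi : w = i₁
      · exact Or.inl (by rw [hi₁, hwi])
      · exact Or.inr (hi₁ ▸ adj_of_mem_hexFaceVertices (faceVertex_mem b w) (faceVertex_mem b i₁)
          (fun e => hwi (faceVertex_injective b e)))
    exact ⟨i₂, hi₂ ▸ hxG, hi₂ ▸ hpath.trans hstep⟩

/-- … in particular a closed path in `G` from `g` to the marked site `v_r`. [cite: BollobasRiordan2006, Ch. 7 Lemma 5 pp. 169–171] -/
theorem closed_chain_to_markSite {g : Site 2} (hgs : g ∈ hexFaceVertices s₀) (hg : g ∈ D.verts) :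
    PathIn triGraph ((D.verts : Set (Site 2)) ∩ σᶜ) g (D.markSite r) := by
  obtain ⟨w, hwG, hpath⟩ := closed_chain_of_reach hξ hξ' hσ hreach hgs hg hreach
  obtain ⟨w₀, h0, h1, h2, -⟩ := isCornerFace_typeII D (yc_spec D r)
  have hww : w = w₀ := by
    rcases fin3_cases₇ w₀ w with e | e | e
    · exact e
    · exact absurd (e ▸ hwG) h1
    · exact absurd (e ▸ hwG) h2
  rw [hww, h0] at hpath
  exact hpath

end whitePath

/-- Auxiliary. [folklore] -/
private theorem fin5_add_ne₆ (j : Fin 5) : j + 1 ≠ j ∧ j + 2 ≠ j ∧ j + 4 ≠ j := by revert j; decide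

/-- Auxiliary. [folklore] -/
private theorem fin5_i_eq_r_add_two {r i : Fin 5} (h : r = i + 3) : i = r + 2 := by
  revert r i; decide

/-- **F2∂ — CLASS SUPPORT AT A BOUNDARY EDGE OF THE ARC `A_i`**: a class `(r, M)` occurring in the boundary six-point space at an
endpoint of a boundary `H_G`-edge of arc `i` (bond `s(g, o)`, dart `(g, o) ∈ D.stretch i`) satisfies `r = i ∨ r = i + 1 ∨ (r = i + 3 ∧ M = A)`
— the five non-crossing perfect matchings of `(z, y_{i+1}, y_{i+2}, y_{i+3}, y_{i+4}, y_i)`. [cite: BollobasRiordan2006, Ch. 7 Lemma 5 pp. 169–171] -/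
theorem classSupport_b {i : Fin 5} {x x' : HexVertex} {g o : Site 2} (hadj : hexGraph.Adj x x') (hd : (g, o) ∈ D.stretch i)
    (he : faceEdge x x' = {g, o}) {s : HexVertex} (hs : s ∈ ({x, x'} : Finset HexVertex)) {r : Fin 5} {m : Bool}
    {ξ : Finset (Sym2 (Site 2))} (hcl : InClassb D g o s r m ξ) : r = i ∨ r = i + 1 ∨ (r = i + 3 ∧ m = false) := by
  classical
  obtain ⟨hdB, hsi⟩ := stretchIdx_of_mem_stretch hd
  obtain ⟨hg, ho, hgo⟩ := mem_triBdryDarts.1 hdB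
  -- orient the edge so that `s` comes first
  obtain ⟨t, hadj', he'⟩ : ∃ t, hexGraph.Adj s t ∧ faceEdge s t = {g, o} := by
    rcases Finset.mem_insert.1 hs with rfl | hs'
    · exact ⟨x', hadj, he⟩
    · obtain rfl := Finset.mem_singleton.1 hs'
      exact ⟨x, hadj.symm, by rw [faceEdge_comm]; exact he⟩
  obtain ⟨hgo', hgs, hos, -, -, hsT, -, -, -, hbB⟩ := edge_facts D hadj' he' hg
  by_cases hsC : s ∈ corners D
  · -- corner endpoint y_k: the class index is k, and (g, o) is the marked dart of k or its predecessor
    obtain ⟨k, hk⟩ := (mem_corners D).1 hsC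
    have hY : IsCornerFace D k s := hk ▸ yc_spec D k
    have hrk : r = k := by
      by_contra hrk
      have h0 := filter_inClassb_corner_eq_empty hadj' he' hg hY hrk m
      have : ξ ∈ (loopSpace6b D g o s).filter (fun ξ => InClassb D g o s r m ξ) := Finset.mem_filter.2 ⟨hcl.1, hcl⟩
      rw [h0] at this
      exact absurd this (Finset.notMem_empty _)
    subst hrk
    have hgk : g = D.markSite r := cornerEnd_fst_eq hadj' he' hg hY
    rcases cornerEnd_snd_eq_or hadj' he' hg hY with ho' | ho'
    · have hdm : (g, o) = D.markDart r := Prod.ext hgk ho'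
      rw [hdm, stretchIdx_markDart] at hsi
      exact Or.inl hsi
    · have hdp : (g, o) = predDart D r := Prod.ext (hgk.trans (predDart_fst D r).symm) ho'
      rw [hdp, stretchIdx_predDart] at hsi
      exact Or.inr (Or.inl (by rw [← hsi, sub_add_cancel]))
  -- non-corner endpoint: the tree space; the component of `s` is a path to `y_r`
  rw [inClassb_iff_of_not_corner g o hsC] at hcl
  obtain ⟨hξ6, ⟨Yr, hYr, hlink⟩, hpat⟩ := hcl
  have hξ6' := hξ6
  unfold loopSpace6 at hξ6'
  obtain ⟨hsub0, hpar⟩ := Finset.mem_filter.1 hξ6'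
  have hE : ξ ⊆ (hBonds D).erase s(g, o) := Finset.mem_powerset.1 hsub0
  have hsub : ξ ⊆ hBonds D := fun e he'' => Finset.mem_of_mem_erase (hE he'')
  have hYr' : Yr = yc D r := eq_yc D hYr
  have hreach : (sideGraph ξ).Reachable s (yc D r) := hYr' ▸ (xiLinked_iff_reachable ξ s Yr).1 hlink
  have hdeg : ∀ F, xiDeg ξ F ≤ 2 := xiDeg_le_two_of_mem_loopSpace6 D hadj' he' hg (Or.inl rfl) hξ6
  have ho_s : Odd (xiDeg ξ s) := (hpar s hsT).2 (Or.inr rfl)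
  obtain ⟨-, huniq⟩ := odd_component D hsub hdeg hsT ho_s
  have hs_not_corner : ∀ k, ¬ IsCornerFace D k s := fun k hk => hsC ((mem_corners D).2 ⟨k, eq_yc D hk⟩)
  have hnot_reach : ∀ (k : Fin 5) (Y : HexVertex), IsCornerFace D k Y → k ≠ r → ¬ (sideGraph ξ).Reachable s Y := by
    intro k Y hYk hkr hr
    have hYT := cornerFace_mem_touching D hYk
    have hYodd : Odd (xiDeg ξ Y) := (hpar Y hYT).2 (Or.inl ⟨k, hYk⟩)
    have hYs : Y ≠ s := fun e => hs_not_corner k (e ▸ hYk)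
    have hrodd : Odd (xiDeg ξ (yc D r)) := (hpar _ (yc_mem_touching D r)).2 (Or.inl ⟨r, yc_spec D r⟩)
    have hrs : yc D r ≠ s := fun e => hs_not_corner r (e ▸ yc_spec D r)
    have := huniq Y (yc D r) hr hreach hYodd hrodd hYs hrs
    exact hkr (cornerFace_idx_unique D hYk (this ▸ yc_spec D r))
  -- delete the component of s; realise the rest by a colouring
  set ξ' : Finset (Sym2 (Site 2)) := ξ.filter fun e => ¬ ∃ F, (sideGraph ξ).Reachable s F ∧ ∃ i : Fin 3, e = side F i
    with hξ'def
  have hξ' : ∀ e, e ∈ ξ' ↔ e ∈ ξ ∧ ¬ ∃ F, (sideGraph ξ).Reachable s F ∧ ∃ i : Fin 3, e = side F i := fun e => by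
    rw [hξ'def, Finset.mem_filter]
  obtain ⟨hzero, hsame, hlink'⟩ := restrict_off_component D hsub s ξ' hξ'
  have hξ'sub : ξ' ⊆ ξ := Finset.filter_subset _ _
  have hξ'mem : ξ' ∈ loopSpace D r := by
    unfold loopSpace
    refine Finset.mem_filter.2 ⟨Finset.mem_powerset.2 (hξ'sub.trans hsub), fun F hF => ?_⟩
    by_cases hr : (sideGraph ξ).Reachable s F
    · rw [hzero F hr]
      constructor
      · intro h0; exact absurd h0 (by decide)
      · rintro ⟨k, hk, hcF⟩
        exact absurd hr (hnot_reach k F hcF hk)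
    · rw [hsame F hr, hpar F hF]
      constructor
      · rintro (⟨k, hcF⟩ | hFs)
        · refine ⟨k, fun e => hr ?_, hcF⟩
          subst e
          rw [cornerFace_unique D hcF (yc_spec D k)]
          exact hreach
        · subst hFs
          exact absurd SimpleGraph.Reachable.rfl hr
      · rintro ⟨k, -, hcF⟩
        exact Or.inl ⟨k, hcF⟩
  obtain ⟨σ, hσ⟩ := loopSurj_holds D r false ξ' hξ'mem
  -- (M1): g is closed, b₀ is not bicoloured, so the arc A_i has the super-arc colour
  obtain ⟨w₀, hw₀⟩ := mem_hexFaceVertices_iff_faceVertex.1 hgs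
  have hgσ : g ∉ σ := by
    rw [hw₀]; exact white_of_reach hsub hξ' hσ hreach SimpleGraph.Reachable.rfl (hw₀ ▸ hg)
  have hb0 : s(g, o) ∉ xiOf D σ r false := by
    rw [hσ]; intro h; exact (Finset.mem_erase.1 (hE (hξ'sub h))).1 rfl
  rw [mem_xiOf_iff' D σ r false hgo (Or.inl hg), bicol_iff_of_mem_not_mem D σ r false hg ho, hsi] at hb0
  have harc : arcColour r false i = false := by
    by_contra h
    exact hb0 (iff_of_false hgσ h)
  rcases (arcColour_false_eq_false_iff r i).1 harc with h | h | h
  · exact Or.inl h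
  · exact Or.inr (Or.inl h)
  -- (M2): r = i + 3; pattern B would give an open crossing A_{r+1} ↔ A_{r+3} against the closed chain A_{r+2} → v_r
  refine Or.inr (Or.inr ⟨h, ?_⟩)
  cases m
  · rfl
  exfalso
  simp only [↓reduceIte] at hpat
  obtain ⟨Y1, Y4, hY1, hY4, hl14⟩ := hpat
  have hY1nr : ¬ (sideGraph ξ).Reachable s Y1 := hnot_reach (r + 1) Y1 hY1 (fin5_add_ne₆ r).1
  have hB : MatchB D σ r false := by
    rw [hlink' Y1 Y4 hY1nr, ← hσ, xiLinked_xiOf_iff] at hl14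
    exact ⟨Y1, Y4, hY1, hY4, hl14⟩
  have hopen : D.IsOpenCrossing σ (r + 1) (r + 3) := ((fiveMarkedLoopLemma_holds D σ r).2.1).1 hB
  have hi : i = r + 2 := fin5_i_eq_r_add_two h
  have hclosed : D.IsClosedCrossing σ (r + 2) r := by
    refine ⟨g, ?_, D.markSite r, D.markSite_mem_arc r, closed_chain_to_markSite hsub hξ' hσ hreach hgs hg⟩
    rw [← hi]
    exact Finset.mem_image.2 ⟨(g, o), hd, rfl⟩
  have hdual := five_markedDomain_duality D σ r
  unfold Xor at hdual
  rcases hdual with ⟨-, hnc⟩ | ⟨-, hno⟩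
  · exact hnc (Or.inr hclosed)
  · exact hno hopen

end Bdry

end Literature.Probability.Percolation.FivePoint

/-! # Door (v-d): the six-point transport at a BOUNDARY edge — part 7: the BOUNDARY SUPPORT law (T-B∂) assembled (b-engine-2 g7) -/

open Finset

namespace Literature.Probability.Percolation.FivePoint

open Literature.Probability.Percolation Literature.Probability.LatticeModels

namespace Bdry

open N5

variable (D : TriMarkedDomain 5)

/-- **(T-B∂) THE BOUNDARY SUPPORT LAW for every five-marked domain**: at a boundary `H_G`-edge of the arc `A_i` (adjacent faces whose
common bond is a dart `(g, o)` of the `i`-th stretch) the pattern probability `H_{r,M}` vanishes for every class `(r, M)` other than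
`(i,A), (i,B), (i+1,A), (i+1,B), (i+3,A)` and every colour — boundary transport F1∂ (`sixTransport_b`) + class support F2∂
(`classSupport_b`). [cite: KhristoforovSmirnov2021, §1.2 (loop configurations, pp. 2–4)] -/
theorem patternProb_eq_zero_of_not_allowed {i : Fin 5} {x x' : HexVertex} {g o : Site 2} (hadj : hexGraph.Adj x x')
    (hd : (g, o) ∈ D.stretch i) (he : faceEdge x x' = {g, o}) (r : Fin 5) (c m : Bool)
    (hnot : ¬ (r = i ∨ r = i + 1 ∨ (r = i + 3 ∧ m = false))) : patternProb D r c m x x' = 0 := by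
  classical
  have hg : g ∈ D.verts := (mem_triBdryDarts.1 (stretchIdx_of_mem_stretch hd).1).1
  rw [ha_patternProb_eq_card_div, ← sixTransport_b D hadj he hg c r m]
  have h0 : ∀ s ∈ ({x, x'} : Finset HexVertex), #((loopSpace6b D g o s).filter fun ξ => InClassb D g o s r m ξ) = 0 := by
    intro s hs
    rw [Finset.card_eq_zero, Finset.filter_eq_empty_iff]
    intro ξ _ hcl
    exact hnot (classSupport_b hadj hd he hs hcl)
  rw [h0 x (by simp), h0 x' (by simp)]
  simp

/-- the same with the boundary edge given by an unordered dart. [cite: KhristoforovSmirnov2021, §1.2 (loop configurations, pp. 2–4)] -/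
theorem patternProb_eq_zero_of_not_allowed' {i : Fin 5} {x x' : HexVertex} (hadj : hexGraph.Adj x x')
    (hbd : ∃ d ∈ D.stretch i, faceEdge x x' = {d.1, d.2}) (r : Fin 5) (c m : Bool)
    (hnot : ¬ (r = i ∨ r = i + 1 ∨ (r = i + 3 ∧ m = false))) : patternProb D r c m x x' = 0 := by
  obtain ⟨d, hd, he⟩ := hbd
  exact patternProb_eq_zero_of_not_allowed D hadj (g := d.1) (o := d.2) hd he r c m hnot

end Bdry

end Literature.Probability.Percolation.FivePoint

/-! # Door (v-d) — part 8: the two boundary laws as named statements, and the boundary values of the sparse observables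
(statements = the lane's typed targets (T-B∂)/(T-N∂), b-step0 g10 text c215adec, carried into the tree namespace; the three one-class
boundary rays are b-step0's consequences, now unconditional) -/

open Finset

namespace Literature.Probability.Percolation.FivePoint

open Literature.Probability.Percolation Literature.Probability.LatticeModels

namespace Bdry

variable (D : TriMarkedDomain 5)

/-- the five classes that can occur at a boundary edge of arc `i`: `(i,A)`, `(i,B)`, `(i+1,A)`, `(i+1,B)`, `(i+3,A)` — the five non-crossing
perfect matchings of the six boundary points `(z, y_{i+1}, y_{i+2}, y_{i+3}, y_{i+4}, y_i)`. [cite: KhristoforovSmirnov2021, §2 eq. (4) (p. 5)] -/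
def AllowedClass (i r : Fin 5) (m : Bool) : Prop := r = i ∨ r = i + 1 ∨ (r = i + 3 ∧ m = false)

/-- decidability of the allowed-class predicate. [folklore] -/
instance (i r : Fin 5) (m : Bool) : Decidable (AllowedClass i r m) := by unfold AllowedClass; infer_instance

/-- `{x, x'}` is a boundary `H_G`-edge of arc `i`: adjacent faces whose common bond is a boundary dart of the `i`-th stretch.
[cite: BollobasRiordan2006, Ch. 7 §7.2.2 pp. 168–171] -/
def IsBoundaryEdge (i : Fin 5) (x x' : HexVertex) : Prop :=
  hexGraph.Adj x x' ∧ ∃ d ∈ D.stretch i, faceEdge x x' = {d.1, d.2}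

/-- **(B∂) BOUNDARY SUPPORT** (statement): at a boundary edge of arc `i` the pattern probability of every class outside the five allowed
ones vanishes, for every colour. [cite: KhristoforovSmirnov2021, §2 eq. (4) (p. 5)] -/
def BoundarySupport (D : TriMarkedDomain 5) : Prop :=
  ∀ (i : Fin 5) (x x' : HexVertex), IsBoundaryEdge D i x x' →
    ∀ (r : Fin 5) (c m : Bool), ¬ AllowedClass i r m → patternProb D r c m x x' = 0

/-- **(N∂) BOUNDARY NORMALISATION** (statement): the five mid-edge probabilities sum to one at boundary edges too.
[cite: KhristoforovSmirnov2021, §2 Definition 3 (p. 4)] -/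
def BoundaryNormalisation (D : TriMarkedDomain 5) : Prop :=
  ∀ (i : Fin 5) (x x' : HexVertex), IsBoundaryEdge D i x x' → ∀ c : Bool, ∑ r : Fin 5, midEdgeProb D r c x x' = 1

/-- **(B∂) holds for every five-marked domain.** [cite: KhristoforovSmirnov2021, §2 eq. (4) (p. 5)] -/
theorem boundarySupport_holds : BoundarySupport D := by
  intro i x x' he r c m hnot
  obtain ⟨hadj, hbd⟩ := he
  exact patternProb_eq_zero_of_not_allowed' D hadj hbd r c m hnot

/-- **(N∂) holds for every five-marked domain.** [cite: KhristoforovSmirnov2021, §2 Definition 3 (p. 4)] -/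
theorem boundaryNormalisation_holds : BoundaryNormalisation D := by
  intro i x x' he c
  obtain ⟨hadj, d, hd, hde⟩ := he
  exact sum_midEdgeProb_eq_one D hadj hde (mem_triBdryDarts.1 (stretchIdx_of_mem_stretch hd).1).1 c

/-! ### Consequences: the boundary values of the sparse observables `F_j = H_{j,A} − τ² H_{j+1,B} − τ H_{j−1,B}` on the arc `A_i`
(typed as consequences of (B∂) by b-step0 g10; unconditional by `boundarySupport_holds`) -/

section consequences

variable {D}

/-- Auxiliary. [folklore] -/
private theorem fin5_facts₈ (i : Fin 5) :
    ¬ AllowedClass i (i + 2) false ∧ ¬ AllowedClass i (i + 2) true ∧ ¬ AllowedClass i (i + 3) true ∧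
    ¬ AllowedClass i (i + 4) false ∧ ¬ AllowedClass i (i + 4) true := by
  revert i; decide

/-- Auxiliary. [folklore] -/
private theorem fin5_arith₈ (i : Fin 5) :
    i + 2 + 1 = i + 3 ∧ i + 2 + 4 = i + 1 ∧ i + 3 + 1 = i + 4 ∧ i + 3 + 4 = i + 2 ∧
    i + 4 + 1 = i ∧ i + 4 + 4 = i + 3 ∧ i + 1 + 1 = i + 2 ∧ i + 1 + 4 = i := by
  revert i; decide

/-- on arc `i`, `F_{i+2}(e) = −τ · H_{i+1,B}(e)` (one class: the ray `−τ·ℝ≥0`). [cite: KhristoforovSmirnov2021, §2 eq. (4) (p. 5)] -/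
theorem sparseObs_arc_add_two {i : Fin 5} {x x' : HexVertex} (he : IsBoundaryEdge D i x x') (c : Bool) :
    sparseObs D (i + 2) c x x' = -(tau * (patternProb D (i + 1) c true x x' : ℂ)) := by
  have hB := boundarySupport_holds D
  obtain ⟨h2A, -, h3B, -, -⟩ := fin5_facts₈ i
  have e1 : patternProb D (i + 2) c false x x' = 0 := hB i x x' he _ c _ h2A
  have e2 : patternProb D (i + 2 + 1) c true x x' = 0 := by
    have : i + 2 + 1 = i + 3 := (fin5_arith₈ i).1
    rw [this]; exact hB i x x' he _ c _ h3B
  have e3 : i + 2 + 4 = i + 1 := (fin5_arith₈ i).2.1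
  unfold sparseObs
  rw [e1, e2, e3]
  push_cast
  ring

/-- on arc `i`, `F_{i+3}(e) = H_{i+3,A}(e)` (one class: real, nonnegative). [cite: KhristoforovSmirnov2021, §2 eq. (4) (p. 5)] -/
theorem sparseObs_arc_add_three {i : Fin 5} {x x' : HexVertex} (he : IsBoundaryEdge D i x x') (c : Bool) :
    sparseObs D (i + 3) c x x' = (patternProb D (i + 3) c false x x' : ℂ) := by
  have hB := boundarySupport_holds D
  obtain ⟨-, h2B, -, -, h4B⟩ := fin5_facts₈ i
  have e2 : patternProb D (i + 3 + 1) c true x x' = 0 := by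
    have : i + 3 + 1 = i + 4 := (fin5_arith₈ i).2.2.1
    rw [this]; exact hB i x x' he _ c _ h4B
  have e3 : patternProb D (i + 3 + 4) c true x x' = 0 := by
    have : i + 3 + 4 = i + 2 := (fin5_arith₈ i).2.2.2.1
    rw [this]; exact hB i x x' he _ c _ h2B
  unfold sparseObs
  rw [e2, e3]
  push_cast
  ring

/-- on arc `i`, `F_{i+4}(e) = −τ² · H_{i,B}(e)` (one class: the ray `−τ²·ℝ≥0`). [cite: KhristoforovSmirnov2021, §2 eq. (4) (p. 5)] -/
theorem sparseObs_arc_add_four {i : Fin 5} {x x' : HexVertex} (he : IsBoundaryEdge D i x x') (c : Bool) :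
    sparseObs D (i + 4) c x x' = -(tau ^ 2 * (patternProb D i c true x x' : ℂ)) := by
  have hB := boundarySupport_holds D
  obtain ⟨-, -, h3B, h4A, -⟩ := fin5_facts₈ i
  have e1 : patternProb D (i + 4) c false x x' = 0 := hB i x x' he _ c _ h4A
  have e2 : i + 4 + 1 = i := (fin5_arith₈ i).2.2.2.2.1
  have e3 : patternProb D (i + 4 + 4) c true x x' = 0 := by
    have : i + 4 + 4 = i + 3 := (fin5_arith₈ i).2.2.2.2.2.1
    rw [this]; exact hB i x x' he _ c _ h3B
  unfold sparseObs
  rw [e1, e2, e3]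
  push_cast
  ring

/-- on arc `i`, `F_i(e) = H_{i,A}(e) − τ² · H_{i+1,B}(e)` (two classes; the third term dies). [cite: KhristoforovSmirnov2021, §2 eq. (4) (p. 5)] -/
theorem sparseObs_arc_self {i : Fin 5} {x x' : HexVertex} (he : IsBoundaryEdge D i x x') (c : Bool) :
    sparseObs D i c x x' = (patternProb D i c false x x' : ℂ) - tau ^ 2 * (patternProb D (i + 1) c true x x' : ℂ) := by
  have hB := boundarySupport_holds D
  obtain ⟨-, -, -, -, h4B⟩ := fin5_facts₈ i
  have e3 : patternProb D (i + 4) c true x x' = 0 := hB i x x' he _ c _ h4B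
  unfold sparseObs
  rw [e3]
  push_cast
  ring

/-- on arc `i`, `F_{i+1}(e) = H_{i+1,A}(e) − τ · H_{i,B}(e)` (two classes; the middle term dies). [cite: KhristoforovSmirnov2021, §2 eq. (4) (p. 5)] -/
theorem sparseObs_arc_add_one {i : Fin 5} {x x' : HexVertex} (he : IsBoundaryEdge D i x x') (c : Bool) :
    sparseObs D (i + 1) c x x' = (patternProb D (i + 1) c false x x' : ℂ) - tau * (patternProb D i c true x x' : ℂ) := by
  have hB := boundarySupport_holds D
  obtain ⟨-, h2B, -, -, -⟩ := fin5_facts₈ i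
  have e2 : patternProb D (i + 1 + 1) c true x x' = 0 := by
    have : i + 1 + 1 = i + 2 := (fin5_arith₈ i).2.2.2.2.2.2.1
    rw [this]; exact hB i x x' he _ c _ h2B
  have e3 : i + 1 + 4 = i := (fin5_arith₈ i).2.2.2.2.2.2.2
  unfold sparseObs
  rw [e2, e3]
  push_cast
  ring

end consequences

end Bdry

end Literature.Probability.Percolation.FivePoint
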